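import Literature.MathematicalPhysics.QuantumChemistry.NRepresentability
import Literature.MathematicalPhysics.QuantumChemistry.SlaterDeterminantRDMs
import HarnessLib

/-!
# Lieb's variational principle: the Hartree–Fock energy over `0 ≤ γ ≤ 1`

Topic `Literature/MathematicalPhysics/QuantumChemistry`; sequel of `MolecularHartreeFockBound.lean`
(`E₀(Ĥ; N) ≤ Re E(γ, γ∧γ)` for every rank-`N` Hermitian PROJECTION `γ` — the Hartree–Fock upper
bound — which lists under NOT here "Lieb's variational principle for non-idempotent `0 ≤ γ ≤ 1`
(BLS94 Thm 2.12, needs repulsive `V`)") and of `SlaterDeterminantRDMs.lean` (every rank-`N`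
projection is the one-matrix of a rotated Slater determinant `Γ(U)|S⟩`). Sources:

* E. H. Lieb, *Variational principle for many-fermion systems*, Phys. Rev. Lett. 46 (1981) 457–459,
  Erratum 47 (1981) 69 (held: reprint in *The Stability of Matter: From Atoms to Stars*, Selecta
  of E. H. Lieb, pp. 263–265): DEFINITIONS (1) (`K` admissible: `0 ≤ K ≤ I`, `Tr K = N`), (3)
  (`ρ¹_N = Σ_j f_j f_j*` for a determinant), (5)–(6) (`K₂(z,w;z',w') = K(z;z')K(w;w') −
  K(z;w')K(w;z')`, `E(K) = Tr(Kh) + ½ Tr(K₂ v)`), and the THEOREM: "Let `v` be positive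
  semidefinite and `K` any admissible single-particle operator. Then (i) there exists a density
  matrix `ρ_N` satisfying the Pauli principle such that `ρ_N¹ = K` and `e₀ ≤ e(ρ_N) ≤ E(K)`;
  (ii) there exists a normalized determinantal function `ψ_N` such that
  `e₀ ≤ ⟨ψ_N, H_N ψ_N⟩ ≤ e(ρ_N) ≤ E(K)`" — "among all admissible `K`, an HF-type `K` [an
  `N`-dimensional projection] gives the lowest value of `E(K)`"; his PROOF of (i): the phase average
  `ρ_N = ⟨ρ_N^θ⟩_θ` of determinants of `F_k^θ = Σ_j e^{iθ_j} V^k_j f_j` (`f_j` the natural orbitals,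
  `V` from his Lemma / Horn's theorem) has `ρ_N¹ = K`, `ρ_N² = K₂ − L₂` with `L₂ ≥ 0`;
* V. Bach, E. H. Lieb, J. P. Solovej, *Generalized Hartree–Fock theory and the Hubbard model*,
  J. Stat. Phys. 76 (1994) 3–89 (held: arXiv:cond-mat/9312044, p. 14): eq. (2c.3)
  `V̂ = ½ Σ V_{kl;mn} c†_k c†_l c_n c_m` with `V` a self-adjoint operator on `𝓗 ⊗ 𝓗` (2c.5); eq.
  (2c.30) "That `V` is positive means that for all `g ∈ 𝓗 ⊗ 𝓗` we have `Σ V_{kl;mn} ḡ_kl g_mn ≥ 0`";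
  **THEOREM 2.12 (Variational principle)**: "If `V` is positive then
  `E^HF(N) := inf{ℰ(γ) | γ admissible, Tr γ = N} = inf{ℰ(γ) | γ an admissible projection, Tr γ = N}`.
  Moreover, if `V` is strictly positive then any HF minimizer must be a projection." (stated there
  without proof: "The proof was first given in [LE1] (see [BV] for a simple proof)"), and eqs.
  (2c.34)–(2c.36): for ANY `0 ≤ γ ≤ 1` with `Tr γ = N`, `E₁(γ) = Tr γh`,
  `E₂(γ) = ½ Σ V_{kl;mn} (γ_mk γ_nl − γ_ml γ_nk)`, **`E^Q ≤ E^HF ≤ E₁(γ) + E₂(γ)`**;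
* V. Bach, *Hartree–Fock theory, Lieb's variational principle, and their generalizations*,
  arXiv:2209.10189 (in: The Physics and Mathematics of Elliott Lieb, vol. I, EMS Press 2022), §III
  pp. 14–16: (III.4)–(III.5) `E_HF(N) = inf{ℰ_HF(γ) | γ = γ* , Tr γ = N, γ = γ²}`,
  `ℰ_HF(γ) = Tr[hγ] + ½ Tr[V(1 − Ex)(γ ⊗ γ)]`; **THEOREM 3 (Lieb's Variational Principle)**
  `E_HF(N) = inf{ℰ_HF(γ) | Tr γ = N, 0 ≤ γ ≤ 1}` (III.6); and THE PROOF OF [3] = Bach (1992)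
  reproduced there: `γ₀ = Σ_j λ_j |f_j⟩⟨f_j|`, `ℰ_HF(γ₀) = Σ λ_i h_i + ½ Σ λ_iλ_j V_{i,j}`,
  `V_{i,j} = ⟨f_i ∧ f_j | V(f_i ∧ f_j)⟩ ≥ 0` (III.7); if two occupations `λ_p, λ_q ∈ (0,1)`
  ("because the sum `Σ λ_j = N` is an integer") move along
  `γ_δ = (λ_p + δ)|f_p⟩⟨f_p| + (λ_q − δ)|f_q⟩⟨f_q| + Σ_{j ≠ p,q} λ_j|f_j⟩⟨f_j|` (III.8), on which
  `δ ↦ ℰ_HF(γ_δ)` is CONCAVE (strictly if `V_{p,q} > 0`), so `min{ℰ(γ_r), ℰ(γ_{−r})} ≤ ℰ(γ₀)`;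
  "this proof is constructive … it defines an algorithm to find the `γ_*` of minimal energy among
  all … `Σ_j τ_j |f_j⟩⟨f_j|` with `0 ≤ τ_j ≤ 1` and `Σ_j τ_j = N`";
* V. Bach, *Error bound for the Hartree–Fock energy of atoms and molecules*, Commun. Math. Phys. 147
  (1992) 527–548 — the origin of this proof (not held, acquisition request acq-10332; cited through
  Bach (2022) §III and BLS94's "[BV]").

THE RESULT, in the tree's finite-basis language (`Λ` spatial orbitals, spin orbitals
`Orb Λ = Λ × {α, β}`, integral tables `h, g, h_nuc`, the FCIDUMP Hamiltonian `molecularHamiltonian`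
= `Ĥ = Σ h_pq E_pq + ½ Σ g_pqrs e_pqrs + h_nuc`, the functional `E(γ, Γ) = rdmEnergy h g h_nuc γ Γ`
of `VariationalRDMRelaxation.lean` and the Slater two-matrix `γ∧γ = slaterTwoRDM γ` of
`MolecularHartreeFockBound.lean`, so that `E(γ, γ∧γ)` IS BLS94's `E₁(γ) + E₂(γ) + h_nuc` and Lieb's
`E(K)`). POSITIVITY OF THE INTERACTION is BLS94's (2c.30): the pair matrix
`⟨p ⊗ r| V |q ⊗ s⟩ = g_pqrs` (`pairMatrix g`; `V_{(pσ)(rτ);(qσ')(sτ')} = δ_σσ' δ_ττ' g_pqrs` is its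
spin-diagonal ampliation) is positive semidefinite — true for every genuine two-electron integral
table `g_pqrs = (pq|rs) = ∬ φ_pφ_q(1) r₁₂⁻¹ φ_rφ_s(2)` (the Galerkin compression of the positive
multiplication operator `r₁₂⁻¹`: `Σ c̄_pr c_qs (pq|rs) = ∬ |Σ c_pr φ_p(1)φ_r(2)|² / r₁₂ ≥ 0`) and for
the repulsive Hubbard interaction (`g_pqrs = U δ_pq δ_rs δ_pr`, `U ≥ 0`), and false for attractive
ones. ADMISSIBLE means `0 ≤ γ`, `0 ≤ 1 − γ`, `tr γ = N` (Lieb's (1)). Then: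

* `exists_isProj_rdmEnergy_le` — **LIEB'S VARIATIONAL PRINCIPLE**: for every admissible `γ` there
  is a rank-`N` Hermitian projection `P` with `Re E(P, P∧P) ≤ Re E(γ, γ∧γ)` (BLS94 Thm 2.12: the
  two infima of (2c.33) agree; Lieb: "an HF-type `K` gives the lowest value of `E(K)`"); the
  constructive core `exists_unitary_indicator_rdmEnergy_le` exhibits `P = Σ_{m∈S} |w_m⟩⟨w_m|` on
  `N` NATURAL ORBITALS `w_m` of `γ` (Bach's algorithm);
* `exists_slaterDeterminant_expect_le` — **Lieb's Theorem (ii)**: there is a Slater determinant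
  `ψ_N = Γ(U)|S⟩` of `N` orthonormal spin orbitals with `Re ⟨ψ_N| Ĥ |ψ_N⟩ ≤ Re E(γ, γ∧γ)`;
* `exists_slaterEnsemble_oneRDM_eq_expect_le` / `exists_isEnsembleNRepresentable_rdmEnergy_le` —
  **Lieb's Theorem (i)**: there is an ENSEMBLE of Slater determinants `Γ(U)|S⟩` (convex weights
  `w_S` on the `N`-sets) whose one-matrix is EXACTLY `γ = Σ_S w_S ¹D(Γ(U)|S⟩)` and whose mean energy
  is `≤ Re E(γ, γ∧γ)`; equivalently a two-matrix `Γ` with `(γ, Γ)` ensemble `N`-representable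
  (`NRepresentability.lean`) and `Re E(γ, Γ) ≤ Re E(γ, γ∧γ)` — a sharpening of Coleman's theorem
  (`ColemanOneMatrixRepresentability.exists_slaterEnsemble_of_le_one`, same shape) by the energy
  clause. The ensemble is NOT Lieb's phase average but Bach's descent RANDOMISED
  (`exists_convexCombination_indicator_pairConcave`: the hypersimplex decomposition of
  `Literature.Analysis.Convex.exists_convexCombination_indicator`, re-run to record that
  `Σ_S w_S F(1_S) ≤ F(λ)` for every pair-concave `F` — a concave parabola lies above its chord);
* `groundEnergy_le_re_rdmEnergy_of_le_one` — **`e₀ ≤ E(K)`** / BLS94 (2c.36)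
  `E^Q ≤ E₁(γ) + E₂(γ)`: `E₀(Ĥ; N) ≤ Re E(γ, γ∧γ)` for every ADMISSIBLE `γ` (the projection
  hypothesis `γ² = γ` of `groundEnergy_le_re_rdmEnergy_slaterTwoRDM` is dropped); also
  `pqgEnergy_le_re_rdmEnergy_of_le_one` (`E_PQG(N) ≤ E₀(N) ≤ …`, the cell's SDP value);
* `hartreeFockEnergy h g h_nuc N = inf{Re E(P, P∧P) | P a rank-N Hermitian projection}` (BLS94
  (2c.9) at particle number `N`; Bach (III.4)) with `groundEnergy_le_hartreeFockEnergy`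
  (`E^Q ≤ E^HF`, no hypothesis), `hartreeFockEnergy_le_re_rdmEnergy` (`E^HF ≤ E₁(γ) + E₂(γ)`,
  (2c.36)) and **`hartreeFockEnergy_eq_sInf_admissible`** — THEOREM 2.12 / THEOREM 3 verbatim:
  `E^HF(N) = inf{Re E(γ, γ∧γ) | γ admissible, tr γ = N}`;
* `mul_self_of_isMinOn_rdmEnergy` — THEOREM 2.12, second sentence: if the pair matrix is positive
  DEFINITE, every admissible minimiser of `γ ↦ Re E(γ, γ∧γ)` is a projection (`γ² = γ`);
* the `S_z`-SECTOR (unrestricted Hartree–Fock, fixed `(N_α, N_β)`) form, obtained by running Bach's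
  descent among natural orbitals of equal spin only (`exists_indicator_le_of_pairConcave_fibre`,
  `exists_spinPure_occupationMatrix_eq`): for a SPIN-BLOCKED admissible `γ` with block traces
  `(a, b)` there is a spin-blocked projection with the same block traces and lower Slater energy
  (`exists_isProj_spinBlocked_rdmEnergy_le`), hence `E₀(Ĥ; a, b) ≤ Re E(γ, γ∧γ)` for Hermitian
  integral data (`sectorGroundEnergy_le_re_rdmEnergy_of_le_one`; also
  `pqgSectorEnergy_le_re_rdmEnergy_of_le_one`) — the `(N_↑, N_↓) = (a, b)` reading of (2c.36) that
  `MolecularHartreeFockBound.lean` gives for projections; the printed theorems fix only `N`.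

THE PROOF FORMALISED is Bach's (Bach (2022) §III (III.7)–(III.8) = Bach (1992)), in finite
dimension where none of his three "simplifying assumptions" is needed: (1) the spectral theorem
writes `γ = Σ_m λ_m |w_m⟩⟨w_m|` (`occupationMatrix W λ`, `eq_occupationMatrix_eigenvectorUnitary`)
with `λ ∈ [0,1]^{Orb Λ}`, `Σ λ = N`; (2) along `λ + t(e_k − e_l)` the one-matrix moves by
`t(|w_k⟩⟨w_k| − |w_l⟩⟨w_l|)` (`occupationMatrix_add_smul_single_sub`), the Slater two-matrix is the
quadratic `(γ + tδ)∧(γ + tδ) = γ∧γ + t·cross + t²·δ∧δ` (`slaterTwoRDM_add_smul`) with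
`δ∧δ = −|w_k ∧ w_l⟩⟨w_k ∧ w_l|` for `δ = |w_k⟩⟨w_k| − |w_l⟩⟨w_l|` (`slaterTwoRDM_columnProj`,
`slaterTwoRDM_columnProj_sub`, `slaterCross_columnProj`), and the affine-linear functional expands
accordingly (`rdmEnergy_slaterTwoRDM_add_smul`); hence `Re E` is the parabola `E + βt − ωt²` with
`ω = ½ Re Σ_στ ⟨A_στ| V |A_στ⟩ ≥ 0` by (2c.30) (`re_rdmEnergy_pairAmplitude_nonneg`,
`re_rdmEnergy_occupationMatrix_pair`) — Bach's `V_{p,q} ≥ 0`; (3) BACH'S DESCENT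
(`exists_indicator_le_of_pairConcave`, pure real analysis on the hypersimplex): a concave parabola on
an interval containing `0` is lowest at an end point, the end point `t = min(1 − λ_k, λ_l)` (or its
mirror) kills one fractional occupation, an integer coordinate sum never leaves exactly one
fractional occupation (`exists_ne_mem_fracSet`), so finitely many steps reach an indicator `1_S`,
`|S| = N`, with `F(1_S) ≤ F(λ)`; (4) `Σ_{m∈S} |w_m⟩⟨w_m|` is a rank-`N` Hermitian projection
(`occupationMatrix_indicator_mul_self`, `trace_occupationMatrix_indicator`) and the one-matrix of
the determinant `Γ(W̄)|S⟩` (`oneRDM_Gamma_single`, `twoRDM_Gamma_single` of the tree), whence the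
corollaries by `groundEnergy_le_re_rdmEnergy_slaterTwoRDM`. The strict form
(`exists_lt_of_pairStrictConcave`, `re_rdmEnergy_pairAmplitude_pos`, `w_k ∧ w_l ≠ 0`) gives the
second sentence of Theorem 2.12. No Hermiticity of `h` or `g` is needed anywhere (real parts are
taken throughout); only (2c.30).

Everything is PROVED (0 sorry); no named facts. NOT here: Lieb's own construction for part (i)
(his Lemma — `N` orthonormal `V^i ∈ ℓ²` with `Σ_i |V^i_j|² = c_j`, "essentially a consequence of
Horn's theorem" — and the phase average; the statement (i) is proved by the randomised descent
instead); existence of Hartree–Fock minimisers and the HF equations (BLS94 Thm 2.14 ff.);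
generalized (BCS) one-matrices with pairing (BLS94 Thm 2.11); infinite-dimensional `𝓗`.

## Mathlib / tree search

Tree (REUSED): `slaterTwoRDM`, `groundEnergy_le_re_rdmEnergy_slaterTwoRDM`
(`MolecularHartreeFockBound`); `rdmEnergy`, `rdmEnergy_rdm` (`VariationalRDMRelaxation`);
`oneRDM_Gamma_single`, `star_dotProduct_Gamma_single` (`ColemanOneMatrixRepresentability`);
`twoRDM_Gamma_single`, `pqgEnergy_le_re_rdmEnergy_slaterTwoRDM` (`SlaterDeterminantRDMs`);
`IsEnsembleNRepresentable`, `isEnsembleNRepresentable_of_ensemble`, `rdmEnergy_sum_smul`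
(`NRepresentability`, `RelaxationSymmetryAveraging`); `isNParticle_Gamma_single_of_mem`
(`ColemanOneMatrixRepresentability`);
`Literature.MathematicalPhysics.QuantumLattice.groundEnergy`, `molecularHamiltonian`. Mathlib:
`Matrix.IsHermitian.spectral_theorem / eigenvectorUnitary / eigenvalues / mulVec_eigenvectorBasis /
trace_eq_sum_eigenvalues`, `Matrix.PosSemidef.eigenvalues_nonneg / dotProduct_mulVec_nonneg /
diagonal / mul_mul_conjTranspose_same`, `Matrix.PosDef.dotProduct_mulVec_pos`,
`Matrix.posSemidef_conjTranspose_mul_self`. `lean search 'Lieb.*[Vv]ariational|hartreeFock|0 ≤ γ'`: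
the tree has the projection case only (`MolecularHartreeFockBound`, `QuantumLattice/HartreeFock*`);
Coleman's theorem (`ColemanOneMatrixRepresentability`) decomposes an admissible `γ` into determinant
one-matrices but says nothing about the (non-convex) Slater functional, and the hypersimplex lemma
(`Literature/Analysis/Convex/HypersimplexVertices`) does not record the chord inequality; Mathlib
has none of it.

## References

* E. H. Lieb, Phys. Rev. Lett. 46 (1981) 457–459; Erratum 47 (1981) 69 — Theorem (i)–(ii), Lemma,
  eqs. (1), (3), (5), (6), (8), (9). [Lieb1981VariationalPrinciple]
* V. Bach, E. H. Lieb, J. P. Solovej, J. Stat. Phys. 76 (1994) 3–89, arXiv:cond-mat/9312044 —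
  Thm 2.12, eqs. (2c.3)–(2c.5), (2c.30), (2c.33)–(2c.36). [BachLiebSolovej1994]
* V. Bach, arXiv:2209.10189 (EMS Press 2022) — §III, Thm 3, eqs. (III.4)–(III.8).
  [Bach2022LiebVariationalPrinciple]
* V. Bach, Commun. Math. Phys. 147 (1992) 527–548 (origin of the proof; cited via the two previous
  items). [Bach1992HFErrorBound]
-/

noncomputable section

namespace Literature.MathematicalPhysics.QuantumChemistry

open Matrix Finset Literature.MathematicalPhysics.QuantumLattice
open scoped ComplexOrder

/-! ### The pair-interaction matrix and positivity of the two-body operator (BLS94 (2c.30)) -/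

section Pair

variable {Λ : Type*} [Fintype Λ]

/-- **The two-electron integrals as an operator on the two-electron space `ℓ²(Λ) ⊗ ℓ²(Λ)`**:
`⟨p ⊗ r| V |q ⊗ s⟩ = g_pqrs = (pq|rs)` (electron 1 scatters `q → p`, electron 2 `s → r`). In
BLS94's notation `V̂ = ½ Σ V_{kl;mn} c†_k c†_l c_n c_m` (2c.3) with `V` self-adjoint on `𝓗 ⊗ 𝓗`
(2c.5), the tree's `½ Σ g_pqrs Σ_στ a†_{pσ}a†_{rτ}a_{sτ}a_{qσ}` has
`V_{(pσ)(rτ);(qσ')(sτ')} = δ_σσ' δ_ττ' g_pqrs`, the spin-diagonal ampliation of this matrix.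
[cite: BachLiebSolovej1994, eqs. (2c.3)-(2c.5)] -/
def pairMatrix (g : Λ → Λ → Λ → Λ → ℂ) : Matrix (Λ × Λ) (Λ × Λ) ℂ :=
  fun a b => g a.1 b.1 a.2 b.2

omit [Fintype Λ] in
/-- Entries of the pair matrix. [cite: BachLiebSolovej1994, eqs. (2c.3)-(2c.5)] -/
theorem pairMatrix_apply (g : Λ → Λ → Λ → Λ → ℂ) (p r q s : Λ) :
    pairMatrix g (p, r) (q, s) = g p q r s := rfl

/-- **"`V` is positive"** (BLS94 (2c.30): `Σ V_{kl;mn} ḡ_kl g_mn ≥ 0` for all `g ∈ 𝓗 ⊗ 𝓗`) in the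
form it is used: for every two-electron amplitude `c`, `Re Σ_pqrs g_pqrs c(p,r) c̄(q,s) ≥ 0`.
[cite: BachLiebSolovej1994, eq. (2c.30)] -/
theorem re_sum_pair_nonneg {g : Λ → Λ → Λ → Λ → ℂ} (hV : (pairMatrix g).PosSemidef)
    (c : Λ → Λ → ℂ) :
    0 ≤ (∑ p, ∑ q, ∑ r, ∑ s, g p q r s * (c p r * star (c q s))).re := by
  have h := hV.dotProduct_mulVec_nonneg (fun a => star (c a.1 a.2))
  have hre := (Complex.le_def.mp h).1
  rw [Complex.zero_re] at hre
  convert hre using 2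
  simp only [dotProduct, mulVec, Pi.star_apply, star_star, Finset.mul_sum, Fintype.sum_prod_type,
    pairMatrix]
  refine Finset.sum_congr rfl fun p _ => ?_
  rw [Finset.sum_comm]
  refine Finset.sum_congr rfl fun r _ => Finset.sum_congr rfl fun q _ =>
    Finset.sum_congr rfl fun s _ => ?_
  ring

end Pair

/-! ### Natural-orbital parametrisation `γ(λ) = Σ_m λ_m |w_m⟩⟨w_m|` (Bach (III.7)–(III.8)) -/

section Occupation

variable {ι : Type*} [Fintype ι] [DecidableEq ι]

/-- The rank-one projector `|w_m⟩⟨w_m|` onto the `m`-th column `w_m` of `W` (Bach's `|f_j⟩⟨f_j|`,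
Lieb's `f_j(z) f_j*(z')`). [cite: Lieb1981VariationalPrinciple, eq. (3)] -/
def columnProj (W : Matrix ι ι ℂ) (m : ι) : Matrix ι ι ℂ := fun i k => W i m * star (W k m)

/-- **`γ(λ) = Σ_m λ_m |w_m⟩⟨w_m|`**: the one-matrix with natural orbitals the columns of `W` and
occupation numbers `λ` — Bach's `γ₀ = Σ_j λ_j |f_j⟩⟨f_j|` (III.7) and, for varying `λ`, his
`γ(τ₁, …, τ_J) = Σ_j τ_j |f_j⟩⟨f_j|`. [cite: Bach2022LiebVariationalPrinciple, eq. (III.7)] -/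
def occupationMatrix (W : Matrix ι ι ℂ) (l : ι → ℝ) : Matrix ι ι ℂ :=
  fun i k => ∑ m, (l m : ℂ) * (W i m * star (W k m))

omit [DecidableEq ι] in
/-- Entries of `γ(λ)`. [cite: Bach2022LiebVariationalPrinciple, eq. (III.7)] -/
theorem occupationMatrix_apply (W : Matrix ι ι ℂ) (l : ι → ℝ) (i k : ι) :
    occupationMatrix W l i k = ∑ m, (l m : ℂ) * (W i m * star (W k m)) := rfl

omit [DecidableEq ι] in
/-- `λ ↦ γ(λ)` is additive. [cite: Bach2022LiebVariationalPrinciple, eq. (III.8)] -/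
theorem occupationMatrix_add (W : Matrix ι ι ℂ) (l l' : ι → ℝ) :
    occupationMatrix W (l + l') = occupationMatrix W l + occupationMatrix W l' := by
  ext i k
  simp only [occupationMatrix, Pi.add_apply, Complex.ofReal_add, add_mul, Finset.sum_add_distrib,
    Matrix.add_apply]

omit [DecidableEq ι] in
/-- `λ ↦ γ(λ)` is homogeneous. [cite: Bach2022LiebVariationalPrinciple, eq. (III.8)] -/
theorem occupationMatrix_smul (W : Matrix ι ι ℂ) (t : ℝ) (l : ι → ℝ) :
    occupationMatrix W (t • l) = (t : ℂ) • occupationMatrix W l := by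
  ext i k
  simp only [occupationMatrix, Pi.smul_apply, smul_eq_mul, Complex.ofReal_mul, mul_assoc,
    Matrix.smul_apply, Finset.mul_sum]

/-- `γ(e_m) = |w_m⟩⟨w_m|`. [cite: Bach2022LiebVariationalPrinciple, eq. (III.7)] -/
theorem occupationMatrix_single (W : Matrix ι ι ℂ) (m : ι) :
    occupationMatrix W (Pi.single m 1) = columnProj W m := by
  ext i k
  simp only [occupationMatrix, columnProj]
  rw [Finset.sum_eq_single m]
  · simp
  · intro b _ hb
    simp [hb]
  · intro h; exact absurd (Finset.mem_univ m) h

/-- **Bach's path (III.8)**: `γ(λ + t(e_k − e_l)) = γ(λ) + t(|w_k⟩⟨w_k| − |w_l⟩⟨w_l|)` — the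
occupation of `w_k` raised and that of `w_l` lowered by `t`, all natural orbitals fixed.
[cite: Bach2022LiebVariationalPrinciple, eq. (III.8)] -/
theorem occupationMatrix_add_smul_single_sub (W : Matrix ι ι ℂ) (l : ι → ℝ) (t : ℝ) (k j : ι) :
    occupationMatrix W (l + t • (Pi.single k 1 - Pi.single j 1)) =
      occupationMatrix W l + (t : ℂ) • (columnProj W k - columnProj W j) := by
  rw [occupationMatrix_add, occupationMatrix_smul, ← occupationMatrix_single W k,
    ← occupationMatrix_single W j]
  congr 2
  have : (Pi.single k (1 : ℝ) - Pi.single j 1) = Pi.single k 1 + (-1 : ℝ) • Pi.single j 1 := by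
    rw [neg_one_smul, sub_eq_add_neg]
  rw [this, occupationMatrix_add, occupationMatrix_smul]
  simp [sub_eq_add_neg]

/-- For an indicator vector, `γ(1_S) = Σ_{m∈S} |w_m⟩⟨w_m|` — Lieb's eq. (3)
`ρ¹_N(z;z') = Σ_{j=1}^N f_j(z) f_j*(z')`, the one-matrix of the determinant of the orbitals
`w_m, m ∈ S`. [cite: Lieb1981VariationalPrinciple, eq. (3)] -/
theorem occupationMatrix_indicator_apply (W : Matrix ι ι ℂ) (S : Finset ι) (i k : ι) :
    occupationMatrix W (fun m => if m ∈ S then 1 else 0) i k = ∑ m ∈ S, W i m * star (W k m) := by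
  simp only [occupationMatrix, apply_ite Complex.ofReal, Complex.ofReal_one, Complex.ofReal_zero,
    ite_mul, one_mul, zero_mul, Finset.sum_ite_mem, Finset.univ_inter]

omit [DecidableEq ι] in
/-- `γ(λ)` is Hermitian (real occupations). [cite: Bach2022LiebVariationalPrinciple, eq. (III.7)] -/
theorem occupationMatrix_isHermitian (W : Matrix ι ι ℂ) (l : ι → ℝ) :
    (occupationMatrix W l).IsHermitian := by
  refine Matrix.IsHermitian.ext fun i k => ?_
  rw [occupationMatrix_apply, occupationMatrix_apply, star_sum]
  refine Finset.sum_congr rfl fun m _ => ?_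
  rw [star_mul', star_mul', star_star, Complex.star_def, Complex.conj_ofReal]
  ring

/-- `γ(λ) = W diag(λ) Wᴴ` (the spectral form). [cite: Bach2022LiebVariationalPrinciple, eq. (III.7)] -/
theorem occupationMatrix_eq_mul_diagonal_mul (W : Matrix ι ι ℂ) (l : ι → ℝ) :
    occupationMatrix W l = W * diagonal (fun m => (l m : ℂ)) * Wᴴ := by
  ext i k
  rw [occupationMatrix_apply, Matrix.mul_apply]
  refine Finset.sum_congr rfl fun m _ => ?_
  rw [mul_diagonal, conjTranspose_apply]
  ring

/-- `γ(λ) ⪰ 0` for nonnegative occupations — the first half of Lieb's admissibility (1) along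
Bach's path ("`0 ≤ γ_δ`"). [cite: Bach2022LiebVariationalPrinciple, eq. (III.8)] -/
theorem occupationMatrix_posSemidef (W : Matrix ι ι ℂ) {l : ι → ℝ} (hl : ∀ m, 0 ≤ l m) :
    (occupationMatrix W l).PosSemidef := by
  rw [occupationMatrix_eq_mul_diagonal_mul]
  exact (Matrix.PosSemidef.diagonal fun m => Complex.zero_le_real.mpr (hl m)).mul_mul_conjTranspose_same W

/-- Orthonormal columns of a unitary: `Σ_j \overline{W_jm} W_jn = δ_mn` (plumbing). [folklore] -/
private theorem sum_star_mul_of_mem_unitaryGroup {W : Matrix ι ι ℂ}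
    (hW : W ∈ Matrix.unitaryGroup ι ℂ) (m n : ι) :
    ∑ j, star (W j m) * W j n = if m = n then 1 else 0 := by
  have h := Matrix.mem_unitaryGroup_iff'.mp hW
  have := congrFun (congrFun h m) n
  rw [Matrix.mul_apply, Matrix.one_apply] at this
  simpa only [star_apply] using this

/-- Completeness of the natural orbitals of a unitary `W`: `Σ_m |w_m⟩⟨w_m| = 1`, so that
`1 − γ(λ) = γ(1 − λ)` ("`γ_δ ≤ 1`" along Bach's path). [cite: Bach2022LiebVariationalPrinciple, eq. (III.8)] -/
theorem occupationMatrix_one {W : Matrix ι ι ℂ} (hW : W ∈ Matrix.unitaryGroup ι ℂ) :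
    occupationMatrix W (fun _ => 1) = 1 := by
  ext i k
  rw [occupationMatrix_apply]
  have h := Matrix.mem_unitaryGroup_iff.mp hW
  have := congrFun (congrFun h i) k
  rw [Matrix.mul_apply] at this
  simpa only [Complex.ofReal_one, one_mul, star_apply] using this

/-- `tr γ(λ) = Σ_m λ_m` for a unitary `W` ("`Tr(γ_δ) = N`" along Bach's path).
[cite: Bach2022LiebVariationalPrinciple, eq. (III.8)] -/
theorem trace_occupationMatrix {W : Matrix ι ι ℂ} (hW : W ∈ Matrix.unitaryGroup ι ℂ)
    (l : ι → ℝ) : (occupationMatrix W l).trace = ∑ m, (l m : ℂ) := by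
  simp only [Matrix.trace, Matrix.diag_apply, occupationMatrix_apply]
  rw [Finset.sum_comm]
  refine Finset.sum_congr rfl fun m _ => ?_
  rw [← Finset.mul_sum, show (∑ i, W i m * star (W i m)) = ∑ j, star (W j m) * W j m from
    Finset.sum_congr rfl fun i _ => mul_comm _ _, sum_star_mul_of_mem_unitaryGroup hW m m, if_pos rfl,
    mul_one]

/-- **`γ(1_S)` is a projection** for a unitary `W` (Lieb: "`K` is an `N`-dimensional projection as
in (3)"). [cite: Lieb1981VariationalPrinciple, eq. (3)] -/
theorem occupationMatrix_indicator_mul_self {W : Matrix ι ι ℂ} (hW : W ∈ Matrix.unitaryGroup ι ℂ)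
    (S : Finset ι) :
    occupationMatrix W (fun m => if m ∈ S then 1 else 0) *
        occupationMatrix W (fun m => if m ∈ S then 1 else 0) =
      occupationMatrix W (fun m => if m ∈ S then 1 else 0) := by
  ext i k
  rw [Matrix.mul_apply]
  simp only [occupationMatrix_indicator_apply]
  calc ∑ j, (∑ m ∈ S, W i m * star (W j m)) * ∑ n ∈ S, W j n * star (W k n)
      = ∑ j, ∑ m ∈ S, ∑ n ∈ S, W i m * star (W k n) * (star (W j m) * W j n) := by
        refine Finset.sum_congr rfl fun j _ => ?_
        rw [Finset.sum_mul_sum]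
        refine Finset.sum_congr rfl fun m _ => Finset.sum_congr rfl fun n _ => ?_
        ring
    _ = ∑ m ∈ S, ∑ n ∈ S, W i m * star (W k n) * ∑ j, star (W j m) * W j n := by
        rw [Finset.sum_comm]
        refine Finset.sum_congr rfl fun m _ => ?_
        rw [Finset.sum_comm]
        refine Finset.sum_congr rfl fun n _ => ?_
        rw [Finset.mul_sum]
    _ = ∑ m ∈ S, W i m * star (W k m) := by
        refine Finset.sum_congr rfl fun m hm => ?_
        simp only [sum_star_mul_of_mem_unitaryGroup hW, mul_ite, mul_one, mul_zero,
          Finset.sum_ite_eq, if_pos hm]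

/-- **`tr γ(1_S) = |S|`**: the projection of an `N`-set of natural orbitals has rank `N` (Lieb:
"`Tr K₂ = (Tr K)² − Tr K²` … is `N(N−1)` iff `K` is an `N`-dimensional projection as in (3)").
[cite: Lieb1981VariationalPrinciple, eq. (3)] -/
theorem trace_occupationMatrix_indicator {W : Matrix ι ι ℂ} (hW : W ∈ Matrix.unitaryGroup ι ℂ)
    (S : Finset ι) :
    (occupationMatrix W (fun m => if m ∈ S then 1 else 0)).trace = S.card := by
  rw [trace_occupationMatrix hW]
  simp only [apply_ite Complex.ofReal, Complex.ofReal_one, Complex.ofReal_zero, Finset.sum_boole,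
    Finset.filter_mem_eq_inter, Finset.univ_inter]

end Occupation

/-! ### The Slater two-matrix along a line (Lieb (5), Bach (III.7)) -/

section Cross

variable {ι : Type*}

/-- The polarisation of Lieb's quadratic map `K ↦ K₂` (5): the coefficient of `t` in
`(γ + tδ)∧(γ + tδ)`. [cite: Lieb1981VariationalPrinciple, eq. (5)] -/
def slaterCross (γ δ : Matrix ι ι ℂ) : Matrix (ι × ι) (ι × ι) ℂ :=
  fun p q => γ p.1 q.1 * δ p.2 q.2 + δ p.1 q.1 * γ p.2 q.2 - γ p.1 q.2 * δ p.2 q.1 -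
    δ p.1 q.2 * γ p.2 q.1

/-- **`(γ + tδ)∧(γ + tδ) = γ∧γ + t·cross(γ, δ) + t²·δ∧δ`** — `K₂` of (5) is quadratic in `K`.
[cite: Lieb1981VariationalPrinciple, eq. (5)] -/
theorem slaterTwoRDM_add_smul (γ δ : Matrix ι ι ℂ) (t : ℂ) :
    slaterTwoRDM (γ + t • δ) = slaterTwoRDM γ + t • slaterCross γ δ + t ^ 2 • slaterTwoRDM δ := by
  ext p q
  simp only [slaterTwoRDM, slaterCross, Matrix.add_apply, Matrix.smul_apply, smul_eq_mul]
  ring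

/-- A rank-one one-matrix has no two-body part: `|w⟩⟨w| ∧ |w⟩⟨w| = 0` (one electron carries no
pair energy; the diagonal `i = j` of Bach's `Σ λ_iλ_j V_{i,j}` vanishes since `f_i ∧ f_i = 0`).
[cite: Bach2022LiebVariationalPrinciple, eq. (III.7)] -/
theorem slaterTwoRDM_columnProj (W : Matrix ι ι ℂ) (m : ι) : slaterTwoRDM (columnProj W m) = 0 := by
  ext p q
  simp only [slaterTwoRDM, columnProj, Matrix.zero_apply]
  ring

/-- `(|w_k⟩⟨w_k| − |w_l⟩⟨w_l|) ∧ (|w_k⟩⟨w_k| − |w_l⟩⟨w_l|) = −cross(|w_k⟩⟨w_k|, |w_l⟩⟨w_l|)`: the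
`t²`-coefficient of the Slater two-matrix along Bach's path is MINUS the cross term.
[cite: Bach2022LiebVariationalPrinciple, eq. (III.8)] -/
theorem slaterTwoRDM_columnProj_sub (W : Matrix ι ι ℂ) (k j : ι) :
    slaterTwoRDM (columnProj W k - columnProj W j) = -slaterCross (columnProj W k) (columnProj W j) := by
  ext p q
  simp only [slaterTwoRDM, slaterCross, columnProj, Matrix.sub_apply, Matrix.neg_apply]
  ring

/-- The cross term of two natural-orbital projectors is `|A⟩⟨A|` for the antisymmetrised pair
amplitude `A(x,y) = w_k(x) w_l(y) − w_l(x) w_k(y)`, i.e. `A = w_k ∧ w_l` — the vector whose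
expectation `V_{k,l} = ⟨f_k ∧ f_l | V (f_k ∧ f_l)⟩` is Bach's pair energy (III.7); Lieb's
`[f_a(z)f_b(w) − f_b(z)f_a(w)][f_a*(z')f_b*(w') − f_b*(z')f_a*(w')]`.
[cite: Bach2022LiebVariationalPrinciple, eq. (III.7)] -/
theorem slaterCross_columnProj (W : Matrix ι ι ℂ) (k j : ι) (p q : ι × ι) :
    slaterCross (columnProj W k) (columnProj W j) p q =
      (W p.1 k * W p.2 j - W p.1 j * W p.2 k) * star (W q.1 k * W q.2 j - W q.1 j * W q.2 k) := by
  simp only [slaterCross, columnProj, star_sub, star_mul']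
  ring

end Cross

/-! ### The energy functional along Bach's path -/

section Energy

variable {Λ : Type*} [LinearOrder Λ] [Fintype Λ]

omit [LinearOrder Λ] in
/-- Expansion of the affine–linear functional `E(γ, Γ) = E₁(γ) + E₂(Γ) + h_nuc` along a quadratic
path: `E(γ + tδ, Γ₀ + tΓ₁ + t²Γ₂) = E(γ, Γ₀) + t·E⁰(δ, Γ₁) + t²·E⁰(0, Γ₂)` with `E⁰` the
functional at `h_nuc = 0` ("a simple computation", Bach after (III.8)).
[cite: Bach2022LiebVariationalPrinciple, eq. (III.8)] -/
theorem rdmEnergy_add_smul_expand (h : Λ → Λ → ℂ) (g : Λ → Λ → Λ → Λ → ℂ) (hnuc : ℂ)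
    (γ δ : Matrix (Orb Λ) (Orb Λ) ℂ) (Γ₀ Γ₁ Γ₂ : Matrix (Orb Λ × Orb Λ) (Orb Λ × Orb Λ) ℂ)
    (t : ℂ) :
    rdmEnergy h g hnuc (γ + t • δ) (Γ₀ + t • Γ₁ + t ^ 2 • Γ₂) =
      rdmEnergy h g hnuc γ Γ₀ + t * rdmEnergy h g 0 δ Γ₁ + t ^ 2 * rdmEnergy h g 0 0 Γ₂ := by
  have hc : ∀ (c x y : ℂ), x * (c * y) = c * (x * y) := fun c x y => mul_left_comm x c y
  simp only [rdmEnergy, Matrix.add_apply, Matrix.smul_apply, Matrix.zero_apply, smul_eq_mul,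
    Finset.sum_add_distrib, mul_add, ← Finset.mul_sum, hc t, hc (t ^ 2), Finset.sum_const_zero,
    mul_zero, add_zero]
  ring

omit [LinearOrder Λ] in
/-- **The Slater energy along a line**: `E(γ + tδ, (γ + tδ)∧(γ + tδ)) =
E(γ, γ∧γ) + t·E⁰(δ, cross(γ,δ)) + t²·E⁰(0, δ∧δ)` (Lieb's `E(K)` (6) is quadratic in `K`).
[cite: Lieb1981VariationalPrinciple, eq. (6)] -/
theorem rdmEnergy_slaterTwoRDM_add_smul (h : Λ → Λ → ℂ) (g : Λ → Λ → Λ → Λ → ℂ) (hnuc : ℂ)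
    (γ δ : Matrix (Orb Λ) (Orb Λ) ℂ) (t : ℂ) :
    rdmEnergy h g hnuc (γ + t • δ) (slaterTwoRDM (γ + t • δ)) =
      rdmEnergy h g hnuc γ (slaterTwoRDM γ) + t * rdmEnergy h g 0 δ (slaterCross γ δ) +
        t ^ 2 * rdmEnergy h g 0 0 (slaterTwoRDM δ) := by
  rw [slaterTwoRDM_add_smul, rdmEnergy_add_smul_expand]

omit [LinearOrder Λ] in
/-- The two-body functional `Γ ↦ E⁰(0, Γ) = ½ Σ g_pqrs Σ_στ Γ_{(pσ,rτ),(qσ,sτ)}` is odd.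
[cite: Lieb1981VariationalPrinciple, eq. (6)] -/
theorem rdmEnergy_zero_zero_neg (h : Λ → Λ → ℂ) (g : Λ → Λ → Λ → Λ → ℂ)
    (Γ : Matrix (Orb Λ × Orb Λ) (Orb Λ × Orb Λ) ℂ) :
    rdmEnergy h g 0 0 (-Γ) = -rdmEnergy h g 0 0 Γ := by
  simp only [rdmEnergy, Matrix.zero_apply, Matrix.neg_apply, Finset.sum_const_zero, mul_zero,
    add_zero, zero_add, Finset.sum_neg_distrib, mul_neg]

omit [LinearOrder Λ] in
/-- Moving the two spin sums out of the two-body contraction (plumbing). [folklore] -/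
private theorem sum_mul_sum_spin (g : Λ → Λ → Λ → Λ → ℂ)
    (f : Fin 2 → Fin 2 → Λ → Λ → Λ → Λ → ℂ) :
    ∑ p, ∑ q, ∑ r, ∑ s, g p q r s * ∑ σ : Fin 2, ∑ τ : Fin 2, f σ τ p q r s =
      ∑ σ : Fin 2, ∑ τ : Fin 2, ∑ p, ∑ q, ∑ r, ∑ s, g p q r s * f σ τ p q r s := by
  simp only [Fin.sum_univ_two, mul_add, Finset.sum_add_distrib]

omit [LinearOrder Λ] in
/-- **The pair energy of an antisymmetrised pair amplitude is nonnegative for positive `V`**: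
`Re E⁰(0, |A⟩⟨A|) = ½ Re Σ_στ ⟨A_στ| V |A_στ⟩ ≥ 0` — Bach's `V_{i,j} = ⟨f_i ∧ f_j|V(f_i ∧ f_j)⟩ ≥ 0`
(III.7), "here the positivity `V ≥ 0` is crucial"; BLS94 (2c.30)–(2c.31).
[cite: Bach2022LiebVariationalPrinciple, eq. (III.7)] -/
theorem re_rdmEnergy_pairAmplitude_nonneg {g : Λ → Λ → Λ → Λ → ℂ} (hV : (pairMatrix g).PosSemidef)
    (h : Λ → Λ → ℂ) (A : Orb Λ × Orb Λ → ℂ) :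
    0 ≤ (rdmEnergy h g 0 0 (fun P Q => A P * star (A Q))).re := by
  simp only [rdmEnergy, Matrix.zero_apply, Finset.sum_const_zero, mul_zero, zero_add, add_zero]
  rw [sum_mul_sum_spin g (fun σ τ p q r s => A (orb p σ, orb r τ) * star (A (orb q σ, orb s τ)))]
  rw [show (1 / 2 : ℂ) = ((1 / 2 : ℝ) : ℂ) by push_cast; ring, Complex.re_ofReal_mul]
  refine mul_nonneg (by norm_num) ?_
  rw [Complex.re_sum]
  refine Finset.sum_nonneg fun σ _ => ?_
  rw [Complex.re_sum]
  refine Finset.sum_nonneg fun τ _ => ?_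
  exact re_sum_pair_nonneg hV (fun p r => A (orb p σ, orb r τ))

/-- **Along Bach's path the Slater energy is a concave parabola** in the occupation shift:
`Re E(γ(λ + t(e_k − e_l))) = Re E(γ(λ)) + βt − ωt²` with `ω = Re E⁰(0, |w_k ∧ w_l⟩⟨w_k ∧ w_l|) ≥ 0`
("a simple computation using that `V_{p,q} > 0` shows the [strict] concavity of
`δ ↦ ℰ_HF(γ_δ)`"; here `V ≥ 0` gives concavity). The natural orbitals `W` are arbitrary here.
[cite: Bach2022LiebVariationalPrinciple, eq. (III.8)] -/
theorem re_rdmEnergy_occupationMatrix_pair {g : Λ → Λ → Λ → Λ → ℂ}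
    (hV : (pairMatrix g).PosSemidef) (h : Λ → Λ → ℂ) (hnuc : ℂ) (W : Matrix (Orb Λ) (Orb Λ) ℂ)
    (l : Orb Λ → ℝ) (k j : Orb Λ) :
    ∃ β ω : ℝ, 0 ≤ ω ∧ ∀ t : ℝ,
      (rdmEnergy h g hnuc (occupationMatrix W (l + t • (Pi.single k 1 - Pi.single j 1)))
          (slaterTwoRDM (occupationMatrix W (l + t • (Pi.single k 1 - Pi.single j 1))))).re =
        (rdmEnergy h g hnuc (occupationMatrix W l) (slaterTwoRDM (occupationMatrix W l))).re +
          β * t - ω * t ^ 2 := by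
  refine ⟨(rdmEnergy h g 0 (columnProj W k - columnProj W j)
      (slaterCross (occupationMatrix W l) (columnProj W k - columnProj W j))).re,
    (rdmEnergy h g 0 0 (slaterCross (columnProj W k) (columnProj W j))).re, ?_, fun t => ?_⟩
  · have hA := re_rdmEnergy_pairAmplitude_nonneg hV h
      (fun P : Orb Λ × Orb Λ => W P.1 k * W P.2 j - W P.1 j * W P.2 k)
    have hc : slaterCross (columnProj W k) (columnProj W j) =
        fun P Q : Orb Λ × Orb Λ => (W P.1 k * W P.2 j - W P.1 j * W P.2 k) *
          star (W Q.1 k * W Q.2 j - W Q.1 j * W Q.2 k) := by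
      ext P Q; exact slaterCross_columnProj W k j P Q
    rw [hc]
    exact hA
  · rw [occupationMatrix_add_smul_single_sub, rdmEnergy_slaterTwoRDM_add_smul,
      slaterTwoRDM_columnProj_sub, rdmEnergy_zero_zero_neg, ← Complex.ofReal_pow]
    simp only [Complex.add_re, Complex.re_ofReal_mul, Complex.neg_re, mul_neg]
    ring

end Energy

/-! ### Bach's descent on the hypersimplex `{λ ∈ [0,1]^ι | Σ λ = N}` (pure real analysis) -/

section Descent

variable {ι : Type*} [Fintype ι]

/-- The indices with fractional occupation `0 < λ_i < 1`. [cite: Bach2022LiebVariationalPrinciple, eq. (III.8)] -/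
private def fracSet (l : ι → ℝ) : Finset ι := univ.filter fun i => 0 < l i ∧ l i < 1

/-- Membership in `fracSet`. [folklore] -/
private theorem mem_fracSet {l : ι → ℝ} {i : ι} : i ∈ fracSet l ↔ 0 < l i ∧ l i < 1 := by
  simp [fracSet]

variable [DecidableEq ι]

/-- If no occupation is fractional, `λ ∈ [0,1]^ι` is the indicator of `{i | λ_i = 1}` (then
`γ(λ)` "is a projection, indeed"). [folklore] -/
private theorem eq_indicator_of_fracSet_eq_empty {l : ι → ℝ} (h0 : ∀ i, 0 ≤ l i)
    (h1 : ∀ i, l i ≤ 1) (he : fracSet l = ∅) :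
    l = fun i => if i ∈ univ.filter (fun i => l i = 1) then (1 : ℝ) else 0 := by
  funext i
  have hi : ¬ (0 < l i ∧ l i < 1) := fun h => by
    have : i ∈ fracSet l := mem_fracSet.mpr h
    rw [he] at this
    exact absurd this (Finset.notMem_empty i)
  simp only [mem_filter, mem_univ, true_and]
  by_cases h : l i = 1
  · simp [h]
  · rw [if_neg h]
    rcases (h0 i).lt_or_eq with hlt | heq
    · exact absurd ⟨hlt, lt_of_le_of_ne (h1 i) h⟩ hi
    · exact heq.symm

/-- The coordinate sum of an indicator vector is the cardinality. [folklore] -/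
private theorem sum_indicator_eq_card (S : Finset ι) :
    ∑ i, (if i ∈ S then (1 : ℝ) else 0) = S.card := by
  rw [Finset.sum_boole]
  simp

/-- **"Because the sum `Σ_j λ_j = N` is an integer"**: a point of the box with integer coordinate
sum never has exactly one fractional coordinate — if `k` is fractional, so is some `l ≠ k`.
[cite: Bach2022LiebVariationalPrinciple, Thm 3 (proof)] -/
private theorem exists_ne_mem_fracSet {l : ι → ℝ} (h0 : ∀ i, 0 ≤ l i) (h1 : ∀ i, l i ≤ 1)
    {N : ℕ} (hN : ∑ i, l i = N) {k : ι} (hk : k ∈ fracSet l) : ∃ j ∈ fracSet l, j ≠ k := by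
  by_contra hcon
  push Not at hcon
  -- every index other than `k` has occupation `0` or `1`
  have hint : ∀ i, i ≠ k → l i = if l i = 1 then 1 else 0 := by
    intro i hik
    by_cases h : l i = 1
    · simp [h]
    · rw [if_neg h]
      rcases (h0 i).lt_or_eq with hlt | heq
      · exact absurd (hcon i (mem_fracSet.mpr ⟨hlt, lt_of_le_of_ne (h1 i) h⟩)) hik
      · exact heq.symm
  set T : Finset ι := (univ.erase k).filter fun i => l i = 1 with hT
  have hsplit : ∑ i, l i = l k + T.card := by
    rw [← Finset.add_sum_erase _ _ (mem_univ k)]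
    congr 1
    rw [hT, ← Finset.sum_boole]
    refine Finset.sum_congr rfl fun i hi => ?_
    exact hint i (Finset.ne_of_mem_erase hi)
  rw [hN] at hsplit
  obtain ⟨hk0, hk1⟩ := mem_fracSet.mp hk
  have h2 : (T.card : ℝ) < N := by linarith
  have h3 : (N : ℝ) < T.card + 1 := by linarith
  have h2' : T.card < N := by exact_mod_cast h2
  have h3' : N < T.card + 1 := by exact_mod_cast h3
  omega

/-- **One step of Bach's descent** (III.8) with `r` replaced by the one-sided reach
`t₀ = min(1 − λ_k, λ_l) > 0`: moving occupation `t₀` from `l` to `k` stays in the box, keeps the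
coordinate sum, and removes `k` or `l` from the fractional set.
[cite: Bach2022LiebVariationalPrinciple, eq. (III.8)] -/
private theorem descentStep {l : ι → ℝ} (h0 : ∀ i, 0 ≤ l i) (h1 : ∀ i, l i ≤ 1) {k j : ι}
    (hkj : k ≠ j) (hk : k ∈ fracSet l) (hj : j ∈ fracSet l) :
    let t₀ : ℝ := min (1 - l k) (l j)
    let l' : ι → ℝ := l + t₀ • (Pi.single k 1 - Pi.single j 1)
    0 < t₀ ∧ (∀ i, 0 ≤ l' i) ∧ (∀ i, l' i ≤ 1) ∧ ∑ i, l' i = ∑ i, l i ∧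
      (fracSet l').card < (fracSet l).card := by
  intro t₀ l'
  obtain ⟨hk0, hk1⟩ := mem_fracSet.mp hk
  obtain ⟨hj0, hj1⟩ := mem_fracSet.mp hj
  have ht0 : 0 < t₀ := lt_min (by linarith) hj0
  have htk : t₀ ≤ 1 - l k := min_le_left _ _
  have htj : t₀ ≤ l j := min_le_right _ _
  have hl'k : l' k = l k + t₀ := by
    simp [l', hkj]
  have hl'j : l' j = l j - t₀ := by
    simp [l', hkj.symm]
    ring
  have hl'i : ∀ i, i ≠ k → i ≠ j → l' i = l i := by
    intro i hik hij
    simp [l', hik, hij]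
  refine ⟨ht0, fun i => ?_, fun i => ?_, ?_, ?_⟩
  · by_cases hik : i = k
    · subst hik; rw [hl'k]; linarith
    by_cases hij : i = j
    · subst hij; rw [hl'j]; linarith
    rw [hl'i i hik hij]; exact h0 i
  · by_cases hik : i = k
    · subst hik; rw [hl'k]; linarith
    by_cases hij : i = j
    · subst hij; rw [hl'j]; linarith
    rw [hl'i i hik hij]; exact h1 i
  · simp only [l', Pi.add_apply, Pi.smul_apply, Pi.sub_apply, smul_eq_mul, Finset.sum_add_distrib,
      ← Finset.mul_sum, Finset.sum_sub_distrib, Finset.sum_pi_single', mem_univ, if_true, sub_self,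
      mul_zero, add_zero]
  · -- the fractional set shrinks: it stays inside the old one and loses `k` or `j`
    have hsub : fracSet l' ⊆ fracSet l := by
      intro i hi
      obtain ⟨hi0, hi1⟩ := mem_fracSet.mp hi
      by_cases hik : i = k
      · subst hik; exact hk
      by_cases hij : i = j
      · subst hij; exact hj
      rw [hl'i i hik hij] at hi0 hi1
      exact mem_fracSet.mpr ⟨hi0, hi1⟩
    have hlost : k ∉ fracSet l' ∨ j ∉ fracSet l' := by
      rcases min_choice (1 - l k) (l j) with h | h
      · left
        rw [mem_fracSet, hl'k, show t₀ = 1 - l k from h]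
        intro hc; linarith [hc.2]
      · right
        rw [mem_fracSet, hl'j, show t₀ = l j from h]
        intro hc; linarith [hc.1]
    apply Finset.card_lt_card
    refine ⟨hsub, fun hsup => ?_⟩
    rcases hlost with h | h
    · exact h (hsup hk)
    · exact h (hsup hj)

/-- **BACH'S DESCENT ("this proof is constructive … it defines an algorithm").** Let
`F : (ι → ℝ) → ℝ` be, along every direction `e_k − e_l`, a concave parabola:
`F(λ + t(e_k − e_l)) = F(λ) + βt − ωt²` with `ω ≥ 0`. Then for every `λ ∈ [0,1]^ι` with integer
coordinate sum `N` there is an `N`-set `S` whose indicator does at least as well: `F(1_S) ≤ F(λ)`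
(induction on the number of fractional occupations; a concave parabola on an interval containing
`0` is lowest at an end point, `min{ℰ(γ_r), ℰ(γ_{−r})} ≤ ℰ(γ₀)`).
[cite: Bach2022LiebVariationalPrinciple, Thm 3 (proof, eq. (III.8))] -/
theorem exists_indicator_le_of_pairConcave (F : (ι → ℝ) → ℝ)
    (hF : ∀ (l : ι → ℝ) (k j : ι), k ≠ j → ∃ β ω : ℝ, 0 ≤ ω ∧
      ∀ t : ℝ, F (l + t • (Pi.single k 1 - Pi.single j 1)) = F l + β * t - ω * t ^ 2)
    {l : ι → ℝ} (h0 : ∀ i, 0 ≤ l i) (h1 : ∀ i, l i ≤ 1) {N : ℕ} (hN : ∑ i, l i = N) :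
    ∃ S : Finset ι, S.card = N ∧ F (fun i => if i ∈ S then 1 else 0) ≤ F l := by
  -- strong induction on the number of fractional occupations
  suffices key : ∀ (m : ℕ) (l : ι → ℝ), (fracSet l).card = m → (∀ i, 0 ≤ l i) → (∀ i, l i ≤ 1) →
      ∑ i, l i = N → ∃ S : Finset ι, S.card = N ∧ F (fun i => if i ∈ S then 1 else 0) ≤ F l from
    key _ l rfl h0 h1 hN
  intro m
  induction m using Nat.strong_induction_on with
  | _ m ih =>
    intro l hm h0 h1 hN
    by_cases he : fracSet l = ∅
    · -- no fractional occupation: `λ` is itself an indicator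
      refine ⟨univ.filter fun i => l i = 1, ?_, ?_⟩
      · have hl := eq_indicator_of_fracSet_eq_empty h0 h1 he
        have hs : ∑ i, l i = (univ.filter fun i => l i = 1).card := by
          conv_lhs => rw [hl]
          exact sum_indicator_eq_card _
        rw [hN] at hs
        exact_mod_cast hs.symm
      · rw [← eq_indicator_of_fracSet_eq_empty h0 h1 he]
    · -- two fractional occupations `k ≠ j`; move along `e_k − e_j` to the cheaper end point
      obtain ⟨k, hk⟩ := Finset.nonempty_iff_ne_empty.mpr he
      obtain ⟨j, hj, hjk⟩ := exists_ne_mem_fracSet h0 h1 hN hk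
      obtain ⟨β, ω, hω, hexp⟩ := hF l k j hjk.symm
      by_cases hβ : β ≤ 0
      · obtain ⟨ht0, h0', h1', hsum, hcard⟩ := descentStep h0 h1 hjk.symm hk hj
        set t₀ : ℝ := min (1 - l k) (l j)
        obtain ⟨S, hS, hle⟩ := ih _ (hm ▸ hcard) _ rfl h0' h1' (hsum.trans hN)
        refine ⟨S, hS, hle.trans ?_⟩
        rw [hexp t₀]
        nlinarith [sq_nonneg t₀]
      · -- `β > 0`: move the other way, i.e. along `e_j − e_k`
        obtain ⟨ht0, h0', h1', hsum, hcard⟩ := descentStep h0 h1 hjk hj hk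
        set t₀ : ℝ := min (1 - l j) (l k)
        obtain ⟨S, hS, hle⟩ := ih _ (hm ▸ hcard) _ rfl h0' h1' (hsum.trans hN)
        refine ⟨S, hS, hle.trans ?_⟩
        have hdir : l + t₀ • (Pi.single j (1 : ℝ) - Pi.single k 1) =
            l + (-t₀) • (Pi.single k (1 : ℝ) - Pi.single j 1) := by
          rw [neg_smul, ← smul_neg, neg_sub]
        rw [hdir, hexp (-t₀)]
        push Not at hβ
        nlinarith [sq_nonneg t₀]

/-- **Strict descent step**: with TWO fractional occupations `k ≠ l` and a STRICTLY concave
parabola along `e_k − e_l` (`ω > 0`, Bach's `V_{p,q} > 0`), some point of the box with the same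
coordinate sum is STRICTLY cheaper: `min{ℰ_HF(γ_r), ℰ_HF(γ_{−r})} < ℰ_HF(γ₀)`.
[cite: Bach2022LiebVariationalPrinciple, Thm 3 (proof, eq. (III.8))] -/
theorem exists_lt_of_pairStrictConcave (F : (ι → ℝ) → ℝ) {l : ι → ℝ} (h0 : ∀ i, 0 ≤ l i)
    (h1 : ∀ i, l i ≤ 1) {k j : ι} (hkj : k ≠ j) (hk : 0 < l k ∧ l k < 1) (hj : 0 < l j ∧ l j < 1)
    {β ω : ℝ} (hω : 0 < ω)
    (hexp : ∀ t : ℝ, F (l + t • (Pi.single k 1 - Pi.single j 1)) = F l + β * t - ω * t ^ 2) :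
    ∃ l' : ι → ℝ, (∀ i, 0 ≤ l' i) ∧ (∀ i, l' i ≤ 1) ∧ ∑ i, l' i = ∑ i, l i ∧ F l' < F l := by
  have hk' : k ∈ fracSet l := mem_fracSet.mpr hk
  have hj' : j ∈ fracSet l := mem_fracSet.mpr hj
  by_cases hβ : β ≤ 0
  · obtain ⟨ht0, h0', h1', hsum, -⟩ := descentStep h0 h1 hkj hk' hj'
    set t₀ : ℝ := min (1 - l k) (l j)
    refine ⟨_, h0', h1', hsum, ?_⟩
    rw [hexp t₀]
    nlinarith [sq_nonneg t₀, mul_pos hω (mul_pos ht0 ht0)]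
  · obtain ⟨ht0, h0', h1', hsum, -⟩ := descentStep h0 h1 hkj.symm hj' hk'
    set t₀ : ℝ := min (1 - l j) (l k)
    refine ⟨_, h0', h1', hsum, ?_⟩
    have hdir : l + t₀ • (Pi.single j (1 : ℝ) - Pi.single k 1) =
        l + (-t₀) • (Pi.single k (1 : ℝ) - Pi.single j 1) := by
      rw [neg_smul, ← smul_neg, neg_sub]
    rw [hdir, hexp (-t₀)]
    push Not at hβ
    nlinarith [sq_nonneg t₀, mul_pos hω (mul_pos ht0 ht0)]

end Descent

/-! ### Lieb's variational principle -/

section Main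

variable {Λ : Type*} [LinearOrder Λ] [Fintype Λ]

/-- **The spectral theorem in the occupation parametrisation**: `γ = Σ_m λ_m |w_m⟩⟨w_m|` with `W`
the eigenvector unitary and `λ` the eigenvalues of the Hermitian `γ` — Bach's starting point
"there exists an orthonormal basis `{f_i}` of eigenvectors of `γ₀` with eigenvalues `λ_i` …
`γ₀ = Σ_j λ_j |f_j⟩⟨f_j|`" (III.7), Lieb's "natural orbitals".
[cite: Bach2022LiebVariationalPrinciple, eq. (III.7)] -/
theorem eq_occupationMatrix_eigenvectorUnitary {ι : Type*} [Fintype ι] [DecidableEq ι]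
    {γ : Matrix ι ι ℂ} (hγ : γ.IsHermitian) :
    γ = occupationMatrix (hγ.eigenvectorUnitary : Matrix ι ι ℂ) hγ.eigenvalues := by
  ext i k
  set W : Matrix ι ι ℂ := (hγ.eigenvectorUnitary : Matrix ι ι ℂ) with hW
  have hspec : γ i k = ∑ m, W i m * (hγ.eigenvalues m : ℂ) * star (W k m) := by
    conv_lhs => rw [hγ.spectral_theorem]
    rw [Unitary.conjStarAlgAut_apply, Matrix.mul_apply]
    refine Finset.sum_congr rfl fun m _ => ?_
    rw [mul_diagonal, Matrix.star_apply, hW]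
    rfl
  rw [hspec, occupationMatrix_apply]
  exact Finset.sum_congr rfl fun m _ => by ring

/-- **LIEB'S VARIATIONAL PRINCIPLE — constructive core (Bach's algorithm).** Let the pair
interaction be positive (BLS94 (2c.30)) and `γ` admissible: `0 ≤ γ`, `0 ≤ 1 − γ`, `tr γ = N`
(Lieb (1)). Then there are a unitary `W` (the natural orbitals of `γ`, as columns) and an `N`-set
`S` of them such that the projection `Σ_{m∈S} |w_m⟩⟨w_m|` has Slater energy at most that of `γ`:
`Re E(γ(1_S), γ(1_S)∧γ(1_S)) ≤ Re E(γ, γ∧γ)` — "fixing the orthonormal orbitals `f_1, …, f_J`, [the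
proof] defines an algorithm to find the `γ_*` of minimal energy among … `Σ_j τ_j|f_j⟩⟨f_j|`".
[cite: Bach2022LiebVariationalPrinciple, Thm 3] -/
theorem exists_unitary_indicator_rdmEnergy_le (h : Λ → Λ → ℂ) {g : Λ → Λ → Λ → Λ → ℂ} (hnuc : ℂ)
    (hV : (pairMatrix g).PosSemidef) {γ : Matrix (Orb Λ) (Orb Λ) ℂ} (hγ : γ.PosSemidef)
    (hγ1 : (1 - γ).PosSemidef) {N : ℕ} (htr : γ.trace = N) :
    ∃ (W : Matrix (Orb Λ) (Orb Λ) ℂ) (S : Finset (Orb Λ)), W ∈ Matrix.unitaryGroup (Orb Λ) ℂ ∧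
      S.card = N ∧
      (rdmEnergy h g hnuc (occupationMatrix W fun m => if m ∈ S then 1 else 0)
          (slaterTwoRDM (occupationMatrix W fun m => if m ∈ S then 1 else 0))).re ≤
        (rdmEnergy h g hnuc γ (slaterTwoRDM γ)).re := by
  classical
  set W : Matrix (Orb Λ) (Orb Λ) ℂ := (hγ.1.eigenvectorUnitary : Matrix (Orb Λ) (Orb Λ) ℂ) with hW
  have hWmem : W ∈ Matrix.unitaryGroup (Orb Λ) ℂ := hγ.1.eigenvectorUnitary.2
  -- the occupation numbers lie in `[0, 1]` and sum to `N`
  have h0 : ∀ m, 0 ≤ hγ.1.eigenvalues m := fun m => hγ.eigenvalues_nonneg m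
  have h1 : ∀ m, hγ.1.eigenvalues m ≤ 1 := by
    intro m
    set v : Orb Λ → ℂ := ⇑(hγ.1.eigenvectorBasis m) with hv
    have hunit : star v ⬝ᵥ v = 1 := by
      rw [dotProduct_comm, hv]
      simp only [← EuclideanSpace.inner_eq_star_dotProduct, inner_self_eq_norm_sq_to_K,
        hγ.1.eigenvectorBasis.orthonormal.1 m]
      simp
    have hev : γ *ᵥ v = ((hγ.1.eigenvalues m : ℝ) : ℂ) • v := by
      rw [hv, hγ.1.mulVec_eigenvectorBasis m, RCLike.real_smul_eq_coe_smul (K := ℂ)]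
      rfl
    have hnn : (0 : ℂ) ≤ star v ⬝ᵥ ((1 - γ) *ᵥ v) := hγ1.dotProduct_mulVec_nonneg v
    rw [sub_mulVec, one_mulVec, dotProduct_sub, hev, dotProduct_smul, hunit, smul_eq_mul, mul_one,
      ← Complex.ofReal_one, ← Complex.ofReal_sub, Complex.zero_le_real] at hnn
    linarith
  have hsum : ∑ m, hγ.1.eigenvalues m = N := by
    have e := hγ.1.trace_eq_sum_eigenvalues
    rw [htr] at e
    apply RCLike.ofReal_injective (K := ℂ)
    push_cast
    exact e.symm
  have hγW : occupationMatrix W hγ.1.eigenvalues = γ :=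
    (eq_occupationMatrix_eigenvectorUnitary hγ.1).symm
  obtain ⟨S, hS, hle⟩ := exists_indicator_le_of_pairConcave
    (fun l => (rdmEnergy h g hnuc (occupationMatrix W l) (slaterTwoRDM (occupationMatrix W l))).re)
    (fun l k j _ => re_rdmEnergy_occupationMatrix_pair hV h hnuc W l k j) h0 h1 hsum
  refine ⟨W, S, hWmem, hS, ?_⟩
  rwa [hγW] at hle

/-- **LIEB'S VARIATIONAL PRINCIPLE (BLS94 THEOREM 2.12, projection form).** If the pair
interaction is positive, then for every admissible one-matrix `γ` (`0 ≤ γ ≤ 1`, `tr γ = N`) there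
is a rank-`N` Hermitian PROJECTION `P` with `Re E(P, P∧P) ≤ Re E(γ, γ∧γ)`: restricting the
infimum of (2c.33) to projections does not raise it; "among all admissible `K`, an HF-type `K` …
gives the lowest value of `E(K)`" (Lieb). [cite: BachLiebSolovej1994, Thm 2.12] -/
theorem exists_isProj_rdmEnergy_le (h : Λ → Λ → ℂ) {g : Λ → Λ → Λ → Λ → ℂ} (hnuc : ℂ)
    (hV : (pairMatrix g).PosSemidef) {γ : Matrix (Orb Λ) (Orb Λ) ℂ} (hγ : γ.PosSemidef)
    (hγ1 : (1 - γ).PosSemidef) {N : ℕ} (htr : γ.trace = N) :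
    ∃ P : Matrix (Orb Λ) (Orb Λ) ℂ, P.IsHermitian ∧ P * P = P ∧ P.trace = N ∧
      (rdmEnergy h g hnuc P (slaterTwoRDM P)).re ≤ (rdmEnergy h g hnuc γ (slaterTwoRDM γ)).re := by
  obtain ⟨W, S, hW, hS, hle⟩ := exists_unitary_indicator_rdmEnergy_le h hnuc hV hγ hγ1 htr
  exact ⟨_, occupationMatrix_isHermitian _ _, occupationMatrix_indicator_mul_self hW S,
    by rw [trace_occupationMatrix_indicator hW, hS], hle⟩

/-- **`e₀ ≤ E(K)` FOR EVERY ADMISSIBLE `K` (Lieb (8)–(9); BLS94 (2c.36) `E^Q ≤ E₁(γ) + E₂(γ)`).**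
For a positive pair interaction and every `γ` on the spin-orbital space with `0 ≤ γ`, `0 ≤ 1 − γ`,
`tr γ = N`: `E₀(Ĥ(h, g, h_nuc); N) ≤ Re E(γ, γ∧γ)` — the Hartree–Fock expression in terms of
direct and exchange energies bounds the exact ground-state energy even when `γ` "does not come from
a determinantal `ψ`" ("the reconstruction problem is eliminated"). The projection hypothesis of
`groundEnergy_le_re_rdmEnergy_slaterTwoRDM` is thus replaced by `0 ≤ γ ≤ 1` plus positivity of
`V`. [cite: Lieb1981VariationalPrinciple, Theorem (ii)] -/
theorem groundEnergy_le_re_rdmEnergy_of_le_one (h : Λ → Λ → ℂ) {g : Λ → Λ → Λ → Λ → ℂ}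
    (hnuc : ℂ) (hV : (pairMatrix g).PosSemidef) {γ : Matrix (Orb Λ) (Orb Λ) ℂ}
    (hγ : γ.PosSemidef) (hγ1 : (1 - γ).PosSemidef) {N : ℕ} (htr : γ.trace = N) :
    Literature.MathematicalPhysics.QuantumLattice.groundEnergy (molecularHamiltonian h g hnuc) N ≤
      (rdmEnergy h g hnuc γ (slaterTwoRDM γ)).re := by
  obtain ⟨P, hP, hPP, hPtr, hle⟩ := exists_isProj_rdmEnergy_le h hnuc hV hγ hγ1 htr
  exact (groundEnergy_le_re_rdmEnergy_slaterTwoRDM h g hnuc hP hPP hPtr).trans hle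

/-- **`E_PQG(N) ≤ E₁(γ) + E₂(γ)` for every admissible `γ`**: the optimal value of the `DQG`
relaxation (`RelaxationEnergyHierarchy.lean`), lying below `E₀(N)` (Nakata et al. (2008) §II.C),
lies below Lieb's functional on the whole admissible set (BLS94 (2c.36) composed with
`E_PQG ≤ E^Q`). [cite: BachLiebSolovej1994, eq. (2c.36)] -/
theorem pqgEnergy_le_re_rdmEnergy_of_le_one (h : Λ → Λ → ℂ) {g : Λ → Λ → Λ → Λ → ℂ} (hnuc : ℂ)
    (hV : (pairMatrix g).PosSemidef) {γ : Matrix (Orb Λ) (Orb Λ) ℂ} (hγ : γ.PosSemidef)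
    (hγ1 : (1 - γ).PosSemidef) {N : ℕ} (htr : γ.trace = N) :
    pqgEnergy h g hnuc N ≤ (rdmEnergy h g hnuc γ (slaterTwoRDM γ)).re := by
  obtain ⟨P, hP, hPP, hPtr, hle⟩ := exists_isProj_rdmEnergy_le h hnuc hV hγ hγ1 htr
  exact (pqgEnergy_le_re_rdmEnergy_slaterTwoRDM h g hnuc hP hPP hPtr).trans hle

/-- **LIEB'S THEOREM (ii): A DETERMINANTAL TRIAL FUNCTION.** "Let `v` be positive semidefinite and
let `K` be any admissible single-particle operator. Then … (ii) there exists a normalized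
determinantal function `ψ_N` such that `e₀ ≤ ⟨ψ_N, H_N ψ_N⟩ ≤ … ≤ E(K)`." Here `ψ_N = Γ(U)|S⟩`,
the Slater determinant of the `N` rotated spin orbitals `U e_m`, `m ∈ S` (a unit `N`-particle vector
by `star_dotProduct_Gamma_single`, `isNParticle_Gamma_single`), built on natural orbitals of `K = γ`.
(Lieb's intermediate `e(ρ_N)` of an `N`-body density matrix with one-matrix exactly `K` — part (i) —
is `exists_isEnsembleNRepresentable_rdmEnergy_le` of section `Ensemble` below.)
[cite: Lieb1981VariationalPrinciple, Theorem (ii)] -/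
theorem exists_slaterDeterminant_expect_le (h : Λ → Λ → ℂ) {g : Λ → Λ → Λ → Λ → ℂ} (hnuc : ℂ)
    (hV : (pairMatrix g).PosSemidef) {γ : Matrix (Orb Λ) (Orb Λ) ℂ} (hγ : γ.PosSemidef)
    (hγ1 : (1 - γ).PosSemidef) {N : ℕ} (htr : γ.trace = N) :
    ∃ (U : Matrix (Orb Λ) (Orb Λ) ℂ) (S : Finset (Orb Λ)), U ∈ Matrix.unitaryGroup (Orb Λ) ℂ ∧
      S.card = N ∧
      (star (Gamma U *ᵥ Pi.single S (1 : ℂ)) ⬝ᵥ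
          molecularHamiltonian h g hnuc *ᵥ (Gamma U *ᵥ Pi.single S (1 : ℂ))).re ≤
        (rdmEnergy h g hnuc γ (slaterTwoRDM γ)).re := by
  obtain ⟨W, S, hW, hS, hle⟩ := exists_unitary_indicator_rdmEnergy_le h hnuc hV hγ hγ1 htr
  have hU : W.map star ∈ Matrix.unitaryGroup (Orb Λ) ℂ := Matrix.map_star_mem_unitaryGroup_iff.mpr hW
  refine ⟨W.map star, S, hU, hS, ?_⟩
  set ψ := Gamma (W.map star) *ᵥ Pi.single S (1 : ℂ) with hψ
  have h1 : star ψ ⬝ᵥ ψ = 1 := star_dotProduct_Gamma_single hU S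
  have hone : oneRDM ψ = occupationMatrix W (fun m => if m ∈ S then 1 else 0) := by
    ext i k
    rw [hψ, oneRDM_Gamma_single hU, occupationMatrix_indicator_apply]
    simp only [Matrix.map_apply, star_star]
  have htwo : twoRDM ψ = slaterTwoRDM (oneRDM ψ) := twoRDM_Gamma_single hU S
  rw [← rdmEnergy_rdm h g hnuc h1, htwo, hone]
  exact hle

end Main

/-! ### The Hartree–Fock energy and BLS94 Theorem 2.12 (infimum form) -/

section HF

variable {Λ : Type*} [LinearOrder Λ] [Fintype Λ]

/-- **The Hartree–Fock energy `E^HF(N)`** of the FCIDUMP Hamiltonian `Ĥ(h, g, h_nuc)`: the infimum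
of the Slater functional `Re E(γ, γ∧γ)` over rank-`N` Hermitian projections `γ` on the spin-orbital
space — BLS94 (2c.9) `E^HF := inf{ℰ(Γ) | Γ admissible}` at fixed particle number `N`, i.e. the
second infimum of (2c.33); Bach (III.4) `E_HF(N) = inf{ℰ_HF(γ) | γ = γ*, Tr γ = N, γ = γ²}` (by
`exists_state_rdmEnergy_slaterTwoRDM_eq` these are exactly the energies of Slater determinants of
`N` orthonormal spin orbitals). Junk value `sInf ∅ = 0` for `N > 2|Λ|`.
[cite: BachLiebSolovej1994, eqs. (2c.9), (2c.33)] -/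
def hartreeFockEnergy (h : Λ → Λ → ℂ) (g : Λ → Λ → Λ → Λ → ℂ) (hnuc : ℂ) (N : ℕ) : ℝ :=
  sInf {E : ℝ | ∃ γ : Matrix (Orb Λ) (Orb Λ) ℂ, γ.IsHermitian ∧ γ * γ = γ ∧ γ.trace = N ∧
    E = (rdmEnergy h g hnuc γ (slaterTwoRDM γ)).re}

/-- **`E^Q ≤ E^HF`** (BLS94 (2c.36), first inequality; Bach: "clearly … `E_HF(N) ≥ E_gs(N)`") — for
every integral table, no positivity needed: every Slater determinant is a trial state. (For
`N > 2|Λ|` both sides are the junk value `0`.) [cite: BachLiebSolovej1994, eq. (2c.36)] -/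
theorem groundEnergy_le_hartreeFockEnergy (h : Λ → Λ → ℂ) (g : Λ → Λ → Λ → Λ → ℂ) (hnuc : ℂ)
    (N : ℕ) :
    Literature.MathematicalPhysics.QuantumLattice.groundEnergy (molecularHamiltonian h g hnuc) N ≤
      hartreeFockEnergy h g hnuc N := by
  classical
  by_cases hne : {E : ℝ | ∃ γ : Matrix (Orb Λ) (Orb Λ) ℂ, γ.IsHermitian ∧ γ * γ = γ ∧
      γ.trace = N ∧ E = (rdmEnergy h g hnuc γ (slaterTwoRDM γ)).re}.Nonempty
  · refine le_csInf hne ?_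
    rintro E ⟨γ, hγ, hγγ, htr, rfl⟩
    exact groundEnergy_le_re_rdmEnergy_slaterTwoRDM h g hnuc hγ hγγ htr
  · -- no rank-`N` projection: `N` exceeds the number of spin orbitals and both sides are `0`
    rw [Set.not_nonempty_iff_eq_empty] at hne
    rw [hartreeFockEnergy, hne, Real.sInf_empty]
    have hN : Fintype.card (Orb Λ) < N := by
      by_contra hle
      push Not at hle
      obtain ⟨S, -, hS⟩ := Finset.exists_subset_card_eq
        (show N ≤ (Finset.univ : Finset (Orb Λ)).card by rwa [Finset.card_univ])
      have hmem : (rdmEnergy h g hnuc (occupationMatrix 1 fun m => if m ∈ S then 1 else 0)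
          (slaterTwoRDM (occupationMatrix 1 fun m => if m ∈ S then 1 else 0))).re ∈
          ({E : ℝ | ∃ γ : Matrix (Orb Λ) (Orb Λ) ℂ, γ.IsHermitian ∧ γ * γ = γ ∧
            γ.trace = N ∧ E = (rdmEnergy h g hnuc γ (slaterTwoRDM γ)).re}) :=
        ⟨_, occupationMatrix_isHermitian _ _,
          occupationMatrix_indicator_mul_self (Submonoid.one_mem _) S,
          by rw [trace_occupationMatrix_indicator (Submonoid.one_mem _), hS], rfl⟩
      rw [hne] at hmem
      exact hmem
    have hempty : {E : ℝ | ∃ ψ : Fock (Orb Λ), IsNParticle N ψ ∧ star ψ ⬝ᵥ ψ = 1 ∧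
        E = (expect (molecularHamiltonian h g hnuc) ψ).re} = ∅ := by
      ext E
      simp only [Set.mem_setOf_eq, Set.mem_empty_iff_false, iff_false, not_exists, not_and]
      intro ψ hψ hnorm _
      have hψ0 : ψ = 0 := by
        funext s
        exact hψ s (by have := Finset.card_le_univ s; omega)
      rw [hψ0, star_zero, zero_dotProduct] at hnorm
      exact zero_ne_one hnorm
    rw [Literature.MathematicalPhysics.QuantumLattice.groundEnergy, hempty, Real.sInf_empty]

/-- The set of single-determinant energies is bounded below by the ground-state energy (plumbing
for the conditionally complete lattice `ℝ`). [folklore] -/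
private theorem bddBelow_hfSet (h : Λ → Λ → ℂ) (g : Λ → Λ → Λ → Λ → ℂ) (hnuc : ℂ) (N : ℕ) :
    BddBelow {E : ℝ | ∃ γ : Matrix (Orb Λ) (Orb Λ) ℂ, γ.IsHermitian ∧ γ * γ = γ ∧ γ.trace = N ∧
      E = (rdmEnergy h g hnuc γ (slaterTwoRDM γ)).re} := by
  refine ⟨Literature.MathematicalPhysics.QuantumLattice.groundEnergy (molecularHamiltonian h g hnuc) N,
    ?_⟩
  rintro E ⟨γ, hγ, hγγ, htr, rfl⟩
  exact groundEnergy_le_re_rdmEnergy_slaterTwoRDM h g hnuc hγ hγγ htr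

/-- **`E^HF ≤ E₁(γ) + E₂(γ)` FOR EVERY ADMISSIBLE `γ`** (BLS94 (2c.36), second inequality; Lieb:
"our bound, `E`, satisfies `E ≥ e_HF` where `e_HF` is the lowest HF energy"): for a positive pair
interaction and `0 ≤ γ`, `0 ≤ 1 − γ`, `tr γ = N`, the Hartree–Fock energy lies below
`Re E(γ, γ∧γ)` — "take any matrix `γ` satisfying `0 ≤ γ ≤ 1` and `Tr γ = N` … nevertheless (2c.36)
continues to be true". [cite: BachLiebSolovej1994, eq. (2c.36)] -/
theorem hartreeFockEnergy_le_re_rdmEnergy (h : Λ → Λ → ℂ) {g : Λ → Λ → Λ → Λ → ℂ} (hnuc : ℂ)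
    (hV : (pairMatrix g).PosSemidef) {γ : Matrix (Orb Λ) (Orb Λ) ℂ} (hγ : γ.PosSemidef)
    (hγ1 : (1 - γ).PosSemidef) {N : ℕ} (htr : γ.trace = N) :
    hartreeFockEnergy h g hnuc N ≤ (rdmEnergy h g hnuc γ (slaterTwoRDM γ)).re := by
  obtain ⟨P, hP, hPP, hPtr, hle⟩ := exists_isProj_rdmEnergy_le h hnuc hV hγ hγ1 htr
  exact (csInf_le (bddBelow_hfSet h g hnuc N) ⟨P, hP, hPP, hPtr, rfl⟩).trans hle

/-- **`E^Q ≤ E^HF ≤ E₁(γ) + E₂(γ)`** (BLS94 (2c.36), both inequalities) for every admissible `γ`.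
[cite: BachLiebSolovej1994, eq. (2c.36)] -/
theorem groundEnergy_le_hartreeFockEnergy_le (h : Λ → Λ → ℂ) {g : Λ → Λ → Λ → Λ → ℂ}
    (hnuc : ℂ) (hV : (pairMatrix g).PosSemidef) {γ : Matrix (Orb Λ) (Orb Λ) ℂ}
    (hγ : γ.PosSemidef) (hγ1 : (1 - γ).PosSemidef) {N : ℕ} (htr : γ.trace = N) :
    Literature.MathematicalPhysics.QuantumLattice.groundEnergy (molecularHamiltonian h g hnuc) N ≤
        hartreeFockEnergy h g hnuc N ∧
      hartreeFockEnergy h g hnuc N ≤ (rdmEnergy h g hnuc γ (slaterTwoRDM γ)).re :=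
  ⟨groundEnergy_le_hartreeFockEnergy h g hnuc N,
    hartreeFockEnergy_le_re_rdmEnergy h hnuc hV hγ hγ1 htr⟩

/-- A Hermitian idempotent is admissible: `0 ≤ P = PᴴP` and `0 ≤ 1 − P = (1 − P)ᴴ(1 − P)` (BLS94:
an "admissible projection"; plumbing). [folklore] -/
private theorem admissible_of_isProj {n : Type*} [Fintype n] [DecidableEq n] {P : Matrix n n ℂ}
    (hP : P.IsHermitian) (hPP : P * P = P) : P.PosSemidef ∧ (1 - P).PosSemidef := by
  have key : ∀ Q : Matrix n n ℂ, Q.IsHermitian → Q * Q = Q → Q.PosSemidef := by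
    intro Q hQ hQQ
    have e : Q = Qᴴ * Q := by rw [hQ.eq, hQQ]
    rw [e]
    exact posSemidef_conjTranspose_mul_self Q
  refine ⟨key P hP hPP, key (1 - P) (Matrix.isHermitian_one.sub hP) ?_⟩
  rw [Matrix.sub_mul, Matrix.mul_sub, Matrix.mul_sub, Matrix.one_mul, Matrix.mul_one,
    Matrix.one_mul, hPP, sub_self, sub_zero]

/-- **BLS94 THEOREM 2.12 / BACH (2022) THEOREM 3 (LIEB'S VARIATIONAL PRINCIPLE, infimum form).**
"If `V` is positive then `E^HF(N) := inf{ℰ(γ) | γ admissible, Tr γ = N} =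
inf{ℰ(γ) | γ an admissible projection, Tr γ = N}`" (2c.33); "the projection property `γ = γ²` in
(III.4) can be relaxed to `0 ≤ γ ≤ 1` without changing the infimum" (III.6): for a positive pair
interaction, `hartreeFockEnergy h g h_nuc N = inf{Re E(γ, γ∧γ) | 0 ≤ γ, 0 ≤ 1 − γ, tr γ = N}`.
(Both sides are the junk value `0` when `N > 2|Λ|`, where no admissible `γ` exists.)
[cite: BachLiebSolovej1994, Thm 2.12] -/
theorem hartreeFockEnergy_eq_sInf_admissible (h : Λ → Λ → ℂ) {g : Λ → Λ → Λ → Λ → ℂ} (hnuc : ℂ)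
    (hV : (pairMatrix g).PosSemidef) (N : ℕ) :
    hartreeFockEnergy h g hnuc N =
      sInf {E : ℝ | ∃ γ : Matrix (Orb Λ) (Orb Λ) ℂ, γ.PosSemidef ∧ (1 - γ).PosSemidef ∧
        γ.trace = N ∧ E = (rdmEnergy h g hnuc γ (slaterTwoRDM γ)).re} := by
  classical
  set A := {E : ℝ | ∃ γ : Matrix (Orb Λ) (Orb Λ) ℂ, γ.PosSemidef ∧ (1 - γ).PosSemidef ∧
    γ.trace = N ∧ E = (rdmEnergy h g hnuc γ (slaterTwoRDM γ)).re} with hA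
  set B := {E : ℝ | ∃ γ : Matrix (Orb Λ) (Orb Λ) ℂ, γ.IsHermitian ∧ γ * γ = γ ∧ γ.trace = N ∧
    E = (rdmEnergy h g hnuc γ (slaterTwoRDM γ)).re} with hB
  have hBA : B ⊆ A := by
    rintro E ⟨γ, hγ, hγγ, htr, rfl⟩
    obtain ⟨h0, h1⟩ := admissible_of_isProj hγ hγγ
    exact ⟨γ, h0, h1, htr, rfl⟩
  have hAbdd : BddBelow A := by
    refine ⟨Literature.MathematicalPhysics.QuantumLattice.groundEnergy (molecularHamiltonian h g hnuc) N, ?_⟩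
    rintro E ⟨γ, hγ, hγ1, htr, rfl⟩
    exact groundEnergy_le_re_rdmEnergy_of_le_one h hnuc hV hγ hγ1 htr
  change sInf B = sInf A
  by_cases hBne : B.Nonempty
  · refine le_antisymm ?_ (csInf_le_csInf hAbdd hBne hBA)
    refine le_csInf (hBne.mono hBA) ?_
    rintro E ⟨γ, hγ, hγ1, htr, rfl⟩
    exact hartreeFockEnergy_le_re_rdmEnergy h hnuc hV hγ hγ1 htr
  · -- no rank-`N` projection exists; then no admissible `γ` of trace `N` exists either
    rw [Set.not_nonempty_iff_eq_empty] at hBne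
    have hAe : A = ∅ := by
      rw [← Set.not_nonempty_iff_eq_empty]
      rintro ⟨E, γ, hγ, hγ1, htr, rfl⟩
      obtain ⟨P, hP, hPP, hPtr, -⟩ := exists_isProj_rdmEnergy_le h hnuc hV hγ hγ1 htr
      have hmem : (rdmEnergy h g hnuc P (slaterTwoRDM P)).re ∈ B := ⟨P, hP, hPP, hPtr, rfl⟩
      rw [hBne] at hmem
      exact hmem
    rw [hBne, hAe]

end HF

/-! ### Strictly positive interaction: minimisers are projections (Thm 2.12, second sentence) -/

section Strict

variable {ι : Type*} [Fintype ι] [DecidableEq ι]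

/-- For a unitary `W` and `k ≠ l` the pair amplitude `w_k ∧ w_l` is nonzero (contracting its
second slot against `w_l` returns the unit vector `w_k`; plumbing). [folklore] -/
private theorem pairAmplitude_ne_zero {W : Matrix ι ι ℂ} (hW : W ∈ Matrix.unitaryGroup ι ℂ)
    {k j : ι} (hkj : k ≠ j) : (fun P : ι × ι => W P.1 k * W P.2 j - W P.1 j * W P.2 k) ≠ 0 := by
  intro hA
  have hcol : ∀ x, W x k = 0 := by
    intro x
    have e : ∑ y, (W x k * W y j - W x j * W y k) * star (W y j) = W x k := by
      simp only [sub_mul, Finset.sum_sub_distrib, mul_assoc, ← Finset.mul_sum]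
      have h1 : ∑ y, W y j * star (W y j) = 1 := by
        rw [show (∑ y, W y j * star (W y j)) = ∑ y, star (W y j) * W y j from
          Finset.sum_congr rfl fun y _ => mul_comm _ _, sum_star_mul_of_mem_unitaryGroup hW,
          if_pos rfl]
      have h2 : ∑ y, W y k * star (W y j) = 0 := by
        have e2 := sum_star_mul_of_mem_unitaryGroup hW j k
        rw [if_neg hkj.symm] at e2
        rw [← e2]
        exact Finset.sum_congr rfl fun y _ => mul_comm _ _
      rw [h1, h2, mul_one, mul_zero, sub_zero]
    rw [← e]
    refine Finset.sum_eq_zero fun y _ => ?_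
    have := congrFun hA (x, y)
    simp only [Pi.zero_apply] at this
    rw [this, zero_mul]
  have hunit := sum_star_mul_of_mem_unitaryGroup hW k k
  rw [if_pos rfl] at hunit
  simp only [hcol, mul_zero, Finset.sum_const_zero] at hunit
  exact zero_ne_one hunit

variable {Λ : Type*} [LinearOrder Λ] [Fintype Λ]

omit [LinearOrder Λ] in
/-- **Strict positivity**: for a positive DEFINITE pair matrix the pair energy of a nonzero pair
amplitude is strictly positive, `Re E⁰(0, |A⟩⟨A|) > 0` (BLS94: "strict positivity means that if
`g ≠ 0` then [(2c.30)] is a strict inequality"; Bach's `V_{i,j} > 0`).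
[cite: BachLiebSolovej1994, eq. (2c.30)] -/
theorem re_rdmEnergy_pairAmplitude_pos {g : Λ → Λ → Λ → Λ → ℂ} (hV : (pairMatrix g).PosDef)
    (h : Λ → Λ → ℂ) {A : Orb Λ × Orb Λ → ℂ} (hA : A ≠ 0) :
    0 < (rdmEnergy h g 0 0 (fun P Q => A P * star (A Q))).re := by
  simp only [rdmEnergy, Matrix.zero_apply, Finset.sum_const_zero, mul_zero, zero_add, add_zero]
  rw [sum_mul_sum_spin g (fun σ τ p q r s => A (orb p σ, orb r τ) * star (A (orb q σ, orb s τ)))]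
  rw [show (1 / 2 : ℂ) = ((1 / 2 : ℝ) : ℂ) by push_cast; ring, Complex.re_ofReal_mul]
  refine mul_pos (by norm_num) ?_
  -- every `(σ, τ)` term is `≥ 0`, and the one carrying a nonzero entry of `A` is `> 0`
  have hterm : ∀ σ τ : Fin 2, (∑ p, ∑ q, ∑ r, ∑ s, g p q r s *
      (A (orb p σ, orb r τ) * star (A (orb q σ, orb s τ)))) =
        star (fun a : Λ × Λ => star (A (orb a.1 σ, orb a.2 τ))) ⬝ᵥ
          (pairMatrix g *ᵥ fun a : Λ × Λ => star (A (orb a.1 σ, orb a.2 τ))) := by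
    intro σ τ
    simp only [dotProduct, mulVec, Pi.star_apply, star_star, Finset.mul_sum, Fintype.sum_prod_type,
      pairMatrix]
    refine Finset.sum_congr rfl fun p _ => ?_
    rw [Finset.sum_comm]
    refine Finset.sum_congr rfl fun r _ => Finset.sum_congr rfl fun q _ =>
      Finset.sum_congr rfl fun s _ => ?_
    ring
  obtain ⟨⟨P, R⟩, hPR⟩ := Function.ne_iff.mp hA
  have hnonneg : ∀ σ τ : Fin 2, 0 ≤ (∑ p, ∑ q, ∑ r, ∑ s, g p q r s *
      (A (orb p σ, orb r τ) * star (A (orb q σ, orb s τ)))).re := by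
    intro σ τ
    rw [hterm]
    have := (Complex.le_def.mp (hV.posSemidef.dotProduct_mulVec_nonneg
      (fun a : Λ × Λ => star (A (orb a.1 σ, orb a.2 τ))))).1
    rwa [Complex.zero_re] at this
  have hpos : 0 < (∑ p, ∑ q, ∑ r, ∑ s, g p q r s *
      (A (orb p (ofLex P).2, orb r (ofLex R).2) *
        star (A (orb q (ofLex P).2, orb s (ofLex R).2)))).re := by
    rw [hterm]
    have hx : (fun a : Λ × Λ => star (A (orb a.1 (ofLex P).2, orb a.2 (ofLex R).2))) ≠ 0 := by
      intro hx
      have := congrFun hx ((ofLex P).1, (ofLex R).1)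
      simp only [Pi.zero_apply, star_eq_zero] at this
      exact hPR this
    have := (Complex.lt_def.mp (hV.dotProduct_mulVec_pos hx)).1
    rwa [Complex.zero_re] at this
  rw [Complex.re_sum]
  refine lt_of_lt_of_le ?_ (Finset.single_le_sum (fun σ _ => by
    rw [Complex.re_sum]; exact Finset.sum_nonneg fun τ _ => hnonneg σ τ) (Finset.mem_univ (ofLex P).2))
  rw [Complex.re_sum]
  exact lt_of_lt_of_le hpos
    (Finset.single_le_sum (fun τ _ => hnonneg _ τ) (Finset.mem_univ (ofLex R).2))

/-- **BLS94 THEOREM 2.12, second sentence: "if `V` is strictly positive then any HF minimizer must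
be a projection."** If the pair matrix is positive DEFINITE and the admissible `γ` (`0 ≤ γ`,
`0 ≤ 1 − γ`, `tr γ = N`) minimises `Re E(·, ·∧·)` over all admissible one-matrices of trace `N`,
then `γ² = γ`. (Bach's argument by contradiction: two fractional occupations would give a STRICTLY
concave parabola (III.8), hence a strictly cheaper admissible `γ_{±r}`; so all occupations are `0`
or `1` "because the sum `Σ λ_j = N` is an integer", and `γ₀ = γ₀²` "is a projection, indeed".)
[cite: BachLiebSolovej1994, Thm 2.12] -/
theorem mul_self_of_isMinOn_rdmEnergy (h : Λ → Λ → ℂ) {g : Λ → Λ → Λ → Λ → ℂ} (hnuc : ℂ)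
    (hV : (pairMatrix g).PosDef) {γ : Matrix (Orb Λ) (Orb Λ) ℂ} (hγ : γ.PosSemidef)
    (hγ1 : (1 - γ).PosSemidef) {N : ℕ} (htr : γ.trace = N)
    (hmin : ∀ γ' : Matrix (Orb Λ) (Orb Λ) ℂ, γ'.PosSemidef → (1 - γ').PosSemidef →
      γ'.trace = N →
      (rdmEnergy h g hnuc γ (slaterTwoRDM γ)).re ≤ (rdmEnergy h g hnuc γ' (slaterTwoRDM γ')).re) :
    γ * γ = γ := by
  classical
  set W : Matrix (Orb Λ) (Orb Λ) ℂ := (hγ.1.eigenvectorUnitary : Matrix (Orb Λ) (Orb Λ) ℂ) with hW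
  have hWmem : W ∈ Matrix.unitaryGroup (Orb Λ) ℂ := hγ.1.eigenvectorUnitary.2
  set ev := hγ.1.eigenvalues with hev'
  have h0 : ∀ m, 0 ≤ ev m := fun m => hγ.eigenvalues_nonneg m
  have h1 : ∀ m, ev m ≤ 1 := by
    intro m
    set v : Orb Λ → ℂ := ⇑(hγ.1.eigenvectorBasis m) with hv
    have hunit : star v ⬝ᵥ v = 1 := by
      rw [dotProduct_comm, hv]
      simp only [← EuclideanSpace.inner_eq_star_dotProduct, inner_self_eq_norm_sq_to_K,
        hγ.1.eigenvectorBasis.orthonormal.1 m]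
      simp
    have hev : γ *ᵥ v = ((hγ.1.eigenvalues m : ℝ) : ℂ) • v := by
      rw [hv, hγ.1.mulVec_eigenvectorBasis m, RCLike.real_smul_eq_coe_smul (K := ℂ)]
      rfl
    have hnn : (0 : ℂ) ≤ star v ⬝ᵥ ((1 - γ) *ᵥ v) := hγ1.dotProduct_mulVec_nonneg v
    rw [sub_mulVec, one_mulVec, dotProduct_sub, hev, dotProduct_smul, hunit, smul_eq_mul, mul_one,
      ← Complex.ofReal_one, ← Complex.ofReal_sub, Complex.zero_le_real] at hnn
    linarith
  have hsum : ∑ m, ev m = N := by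
    have e := hγ.1.trace_eq_sum_eigenvalues
    rw [htr] at e
    apply RCLike.ofReal_injective (K := ℂ)
    push_cast
    exact e.symm
  have hγW : occupationMatrix W ev = γ := (eq_occupationMatrix_eigenvectorUnitary hγ.1).symm
  -- admissibility of every point of the natural-orbital box with coordinate sum `N`
  have hadm : ∀ l : Orb Λ → ℝ, (∀ m, 0 ≤ l m) → (∀ m, l m ≤ 1) → ∑ m, l m = N →
      (occupationMatrix W l).PosSemidef ∧ (1 - occupationMatrix W l).PosSemidef ∧
        (occupationMatrix W l).trace = N := by
    intro l hl0 hl1 hls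
    refine ⟨occupationMatrix_posSemidef W hl0, ?_, ?_⟩
    · have e : 1 - occupationMatrix W l = occupationMatrix W (fun m => 1 - l m) := by
        rw [← occupationMatrix_one hWmem]
        have : (fun m => (1 : ℝ) - l m) = (fun _ => (1 : ℝ)) + (-1 : ℝ) • l := by
          funext m; simp [sub_eq_add_neg]
        rw [this, occupationMatrix_add, occupationMatrix_smul]
        simp [sub_eq_add_neg]
      rw [e]
      exact occupationMatrix_posSemidef W fun m => by linarith [hl1 m]
    · rw [trace_occupationMatrix hWmem, ← Complex.ofReal_sum, hls, Complex.ofReal_natCast]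
  -- no fractional occupation: otherwise a strict descent step contradicts minimality
  have hfrac : fracSet ev = ∅ := by
    by_contra hne
    obtain ⟨k, hk⟩ := Finset.nonempty_iff_ne_empty.mpr hne
    obtain ⟨j, hj, hjk⟩ := exists_ne_mem_fracSet h0 h1 hsum hk
    -- the strict parabola along `e_k − e_j`
    have hexp : ∀ t : ℝ,
        (rdmEnergy h g hnuc (occupationMatrix W (ev + t • (Pi.single k 1 - Pi.single j 1)))
          (slaterTwoRDM (occupationMatrix W (ev + t • (Pi.single k 1 - Pi.single j 1))))).re =
        (rdmEnergy h g hnuc (occupationMatrix W ev) (slaterTwoRDM (occupationMatrix W ev))).re +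
          (rdmEnergy h g 0 (columnProj W k - columnProj W j)
            (slaterCross (occupationMatrix W ev) (columnProj W k - columnProj W j))).re * t -
          (rdmEnergy h g 0 0 (slaterCross (columnProj W k) (columnProj W j))).re * t ^ 2 := by
      intro t
      rw [occupationMatrix_add_smul_single_sub, rdmEnergy_slaterTwoRDM_add_smul,
        slaterTwoRDM_columnProj_sub, rdmEnergy_zero_zero_neg, ← Complex.ofReal_pow]
      simp only [Complex.add_re, Complex.re_ofReal_mul, Complex.neg_re, mul_neg]
      ring
    have hω : 0 < (rdmEnergy h g 0 0 (slaterCross (columnProj W k) (columnProj W j))).re := by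
      have hc : slaterCross (columnProj W k) (columnProj W j) =
          fun P Q : Orb Λ × Orb Λ => (W P.1 k * W P.2 j - W P.1 j * W P.2 k) *
            star (W Q.1 k * W Q.2 j - W Q.1 j * W Q.2 k) := by
        ext P Q; exact slaterCross_columnProj W k j P Q
      rw [hc]
      exact re_rdmEnergy_pairAmplitude_pos hV h (pairAmplitude_ne_zero hWmem hjk.symm)
    obtain ⟨l', hl0, hl1, hls, hlt⟩ := exists_lt_of_pairStrictConcave
      (fun l => (rdmEnergy h g hnuc (occupationMatrix W l) (slaterTwoRDM (occupationMatrix W l))).re)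
      h0 h1 hjk.symm (mem_fracSet.mp hk) (mem_fracSet.mp hj) hω hexp
    obtain ⟨hP, hP1, hPtr⟩ := hadm l' hl0 hl1 (hls.trans hsum)
    have := hmin _ hP hP1 hPtr
    rw [← hγW] at this
    exact absurd this (not_le.mpr hlt)
  -- hence `γ = Σ_{λ_m = 1} |w_m⟩⟨w_m|` is a projection
  have hind := eq_indicator_of_fracSet_eq_empty h0 h1 hfrac
  rw [← hγW, hind]
  exact occupationMatrix_indicator_mul_self hWmem _

end Strict

/-! ### The `S_z`-sector (unrestricted Hartree–Fock) form: fixed `(N_α, N_β)` -/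

section Sector

variable {ι : Type*} [Fintype ι] [DecidableEq ι]

/-- Integrality within a fibre: if the occupations of the colour class of a fractional `k` sum to an
integer, the class contains another fractional index (Bach's "because the sum is an integer", per
class). [cite: Bach2022LiebVariationalPrinciple, Thm 3 (proof)] -/
private theorem exists_ne_mem_fracSet_fibre {κ : Type*} [DecidableEq κ] (c : ι → κ) {l : ι → ℝ}
    (h0 : ∀ i, 0 ≤ l i) (h1 : ∀ i, l i ≤ 1) {k : ι} {N : ℕ}
    (hN : ∑ i ∈ univ.filter (fun i => c i = c k), l i = N) (hk : k ∈ fracSet l) :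
    ∃ j ∈ fracSet l, j ≠ k ∧ c j = c k := by
  classical
  by_contra hcon
  push Not at hcon
  -- every index of the class other than `k` has occupation `0` or `1`
  have hint : ∀ i, i ≠ k → c i = c k → l i = if l i = 1 then 1 else 0 := by
    intro i hik hci
    by_cases h : l i = 1
    · simp [h]
    · rw [if_neg h]
      rcases (h0 i).lt_or_eq with hlt | heq
      · exact absurd hci (hcon i (mem_fracSet.mpr ⟨hlt, lt_of_le_of_ne (h1 i) h⟩) hik)
      · exact heq.symm
  set C : Finset ι := univ.filter (fun i => c i = c k) with hC
  have hkC : k ∈ C := by simp [hC]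
  set T : Finset ι := (C.erase k).filter fun i => l i = 1 with hT
  have hsplit : ∑ i ∈ C, l i = l k + T.card := by
    rw [← Finset.add_sum_erase _ _ hkC]
    congr 1
    rw [hT, ← Finset.sum_boole]
    refine Finset.sum_congr rfl fun i hi => ?_
    have hi' := Finset.mem_erase.mp hi
    exact hint i hi'.1 (by simpa [hC] using hi'.2)
  rw [hN] at hsplit
  obtain ⟨hk0, hk1⟩ := mem_fracSet.mp hk
  have h2 : (T.card : ℝ) < N := by linarith
  have h3 : (N : ℝ) < T.card + 1 := by linarith
  have h2' : T.card < N := by exact_mod_cast h2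
  have h3' : N < T.card + 1 := by exact_mod_cast h3
  omega

/-- **BACH'S DESCENT WITHIN FIBRES.** As `exists_indicator_le_of_pairConcave`, but the index set is
coloured by `c : ι → κ`, the parabola hypothesis is only used for pairs of EQUAL colour, and each
colour class has an integer occupation sum `N_a`; the resulting indicator then has `N_a` elements of
colour `a` (the descent (III.8) with `p, q` of the same colour never changes a class sum — for the
spin colouring: Bach's algorithm run separately on the `α` and `β` natural orbitals keeps
`(N_α, N_β)`). [cite: Bach2022LiebVariationalPrinciple, Thm 3 (proof, eq. (III.8))] -/
theorem exists_indicator_le_of_pairConcave_fibre {κ : Type*} [DecidableEq κ] (c : ι → κ)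
    (F : (ι → ℝ) → ℝ)
    (hF : ∀ (l : ι → ℝ) (k j : ι), k ≠ j → c k = c j → ∃ β ω : ℝ, 0 ≤ ω ∧
      ∀ t : ℝ, F (l + t • (Pi.single k 1 - Pi.single j 1)) = F l + β * t - ω * t ^ 2)
    {l : ι → ℝ} (h0 : ∀ i, 0 ≤ l i) (h1 : ∀ i, l i ≤ 1) (N : κ → ℕ)
    (hN : ∀ a, ∑ i ∈ univ.filter (fun i => c i = a), l i = N a) :
    ∃ S : Finset ι, (∀ a, (S.filter fun i => c i = a).card = N a) ∧
      F (fun i => if i ∈ S then 1 else 0) ≤ F l := by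
  -- class sums are invariant under a same-colour move
  have hmove : ∀ (l : ι → ℝ) (k j : ι) (t : ℝ), c k = c j → ∀ a,
      ∑ i ∈ univ.filter (fun i => c i = a), (l + t • (Pi.single k 1 - Pi.single j 1) : ι → ℝ) i =
        ∑ i ∈ univ.filter (fun i => c i = a), l i := by
    intro l k j t hkj a
    simp only [Pi.add_apply, Pi.smul_apply, Pi.sub_apply, smul_eq_mul, Finset.sum_add_distrib,
      ← Finset.mul_sum, Finset.sum_sub_distrib, Finset.sum_pi_single', Finset.mem_filter,
      Finset.mem_univ, true_and, hkj, sub_self, mul_zero, add_zero]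
  suffices key : ∀ (m : ℕ) (l : ι → ℝ), (fracSet l).card = m → (∀ i, 0 ≤ l i) → (∀ i, l i ≤ 1) →
      (∀ a, ∑ i ∈ univ.filter (fun i => c i = a), l i = N a) →
      ∃ S : Finset ι, (∀ a, (S.filter fun i => c i = a).card = N a) ∧
        F (fun i => if i ∈ S then 1 else 0) ≤ F l from
    key _ l rfl h0 h1 hN
  intro m
  induction m using Nat.strong_induction_on with
  | _ m ih =>
    intro l hm h0 h1 hN
    by_cases he : fracSet l = ∅
    · refine ⟨univ.filter fun i => l i = 1, fun a => ?_, ?_⟩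
      · have hl := eq_indicator_of_fracSet_eq_empty h0 h1 he
        have hs : ∑ i ∈ univ.filter (fun i => c i = a), l i =
            ∑ i ∈ univ.filter (fun i => c i = a),
              (if i ∈ univ.filter (fun i => l i = 1) then (1 : ℝ) else 0) :=
          Finset.sum_congr rfl fun i _ => congrFun hl i
        have hsets : (univ.filter fun i => c i = a).filter
            (fun i => i ∈ univ.filter (fun i => l i = 1)) =
            (univ.filter fun i => l i = 1).filter fun i => c i = a := by
          ext i
          simp [and_comm]
        have hNa := hN a
        rw [hs, Finset.sum_boole, hsets] at hNa
        exact_mod_cast hNa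
      · rw [← eq_indicator_of_fracSet_eq_empty h0 h1 he]
    · obtain ⟨k, hk⟩ := Finset.nonempty_iff_ne_empty.mpr he
      obtain ⟨j, hj, hjk, hcj⟩ := exists_ne_mem_fracSet_fibre c h0 h1 (hN (c k)) hk
      obtain ⟨β, ω, hω, hexp⟩ := hF l k j hjk.symm hcj.symm
      by_cases hβ : β ≤ 0
      · obtain ⟨ht0, h0', h1', -, hcard⟩ := descentStep h0 h1 hjk.symm hk hj
        set t₀ : ℝ := min (1 - l k) (l j)
        obtain ⟨S, hS, hle⟩ := ih _ (hm ▸ hcard) _ rfl h0' h1'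
          (fun a => (hmove l k j t₀ hcj.symm a).trans (hN a))
        refine ⟨S, hS, hle.trans ?_⟩
        rw [hexp t₀]
        nlinarith [sq_nonneg t₀]
      · obtain ⟨ht0, h0', h1', -, hcard⟩ := descentStep h0 h1 hjk hj hk
        set t₀ : ℝ := min (1 - l j) (l k)
        obtain ⟨S, hS, hle⟩ := ih _ (hm ▸ hcard) _ rfl h0' h1'
          (fun a => (hmove l j k t₀ hcj a).trans (hN a))
        refine ⟨S, hS, hle.trans ?_⟩
        have hdir : l + t₀ • (Pi.single j (1 : ℝ) - Pi.single k 1) =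
            l + (-t₀) • (Pi.single k (1 : ℝ) - Pi.single j 1) := by
          rw [neg_smul, ← smul_neg, neg_sub]
        rw [hdir, hexp (-t₀)]
        push Not at hβ
        nlinarith [sq_nonneg t₀]

variable {Λ : Type*} [LinearOrder Λ] [Fintype Λ]

/-- **Spin-pure natural orbitals.** A spin-blocked admissible one-matrix (`γ_{xσ,yτ} = 0` for
`σ ≠ τ`, `0 ≤ γ ≤ 1`) is `Σ_M λ_M |w_M⟩⟨w_M|` for a unitary `W` whose columns are SPIN-PURE
(`W_{(xσ),(mτ)} = 0` for `σ ≠ τ`: the natural orbitals of the two blocks, diagonalised separately)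
with occupations `λ ∈ [0,1]` whose spin-`σ` part sums to the block trace `Σ_x γ_{xσ,xσ}` — the
starting point (III.7) of Bach's proof, one spin species at a time.
[cite: Bach2022LiebVariationalPrinciple, eq. (III.7)] -/
theorem exists_spinPure_occupationMatrix_eq {γ : Matrix (Orb Λ) (Orb Λ) ℂ} (hγ : γ.PosSemidef)
    (hγ1 : (1 - γ).PosSemidef)
    (hblock : ∀ (x y : Λ) (σ τ : Fin 2), σ ≠ τ → γ (orb x σ) (orb y τ) = 0) :
    ∃ (W : Matrix (Orb Λ) (Orb Λ) ℂ) (l : Orb Λ → ℝ), W ∈ Matrix.unitaryGroup (Orb Λ) ℂ ∧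
      (∀ (x m : Λ) (σ τ : Fin 2), σ ≠ τ → W (orb x σ) (orb m τ) = 0) ∧
      (∀ M, 0 ≤ l M) ∧ (∀ M, l M ≤ 1) ∧ occupationMatrix W l = γ ∧
      ∀ σ : Fin 2, ((∑ m : Λ, l (orb m σ) : ℝ) : ℂ) = ∑ x : Λ, γ (orb x σ) (orb x σ) := by
  classical
  -- the two diagonal blocks and their spectral data
  set blk : Fin 2 → Matrix Λ Λ ℂ := fun σ => fun x y => γ (orb x σ) (orb y σ) with hblk
  have hsub : ∀ σ, blk σ = γ.submatrix (fun x => orb x σ) (fun x => orb x σ) := fun σ => rfl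
  have hpsd : ∀ σ, (blk σ).PosSemidef := fun σ => by
    rw [hsub]; exact hγ.submatrix _
  have hpsd1 : ∀ σ, (1 - blk σ).PosSemidef := fun σ => by
    have e : 1 - blk σ = (1 - γ).submatrix (fun x => orb x σ) (fun x => orb x σ) := by
      ext x y
      simp only [Matrix.sub_apply, Matrix.submatrix_apply, Matrix.one_apply, hblk, orb_eq_orb_iff,
        and_true]
    rw [e]; exact hγ1.submatrix _
  set U : Fin 2 → Matrix Λ Λ ℂ := fun σ => ((hpsd σ).1.eigenvectorUnitary : Matrix Λ Λ ℂ) with hU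
  have hUmem : ∀ σ, U σ ∈ Matrix.unitaryGroup Λ ℂ := fun σ => (hpsd σ).1.eigenvectorUnitary.2
  set ev : Fin 2 → Λ → ℝ := fun σ => (hpsd σ).1.eigenvalues with hev
  have hev0 : ∀ σ m, 0 ≤ ev σ m := fun σ m => (hpsd σ).eigenvalues_nonneg m
  have hev1 : ∀ σ m, ev σ m ≤ 1 := by
    intro σ m
    set v : Λ → ℂ := ⇑((hpsd σ).1.eigenvectorBasis m) with hv
    have hunit : star v ⬝ᵥ v = 1 := by
      rw [dotProduct_comm, hv]
      simp only [← EuclideanSpace.inner_eq_star_dotProduct, inner_self_eq_norm_sq_to_K,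
        (hpsd σ).1.eigenvectorBasis.orthonormal.1 m]
      simp
    have hevv : blk σ *ᵥ v = ((ev σ m : ℝ) : ℂ) • v := by
      rw [hv, (hpsd σ).1.mulVec_eigenvectorBasis m, RCLike.real_smul_eq_coe_smul (K := ℂ)]
      rfl
    have hnn : (0 : ℂ) ≤ star v ⬝ᵥ ((1 - blk σ) *ᵥ v) := (hpsd1 σ).dotProduct_mulVec_nonneg v
    rw [sub_mulVec, one_mulVec, dotProduct_sub, hevv, dotProduct_smul, hunit, smul_eq_mul, mul_one,
      ← Complex.ofReal_one, ← Complex.ofReal_sub, Complex.zero_le_real] at hnn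
    linarith
  have hblkW : ∀ σ, occupationMatrix (U σ) (ev σ) = blk σ := fun σ =>
    (eq_occupationMatrix_eigenvectorUnitary (hpsd σ).1).symm
  -- the spin-pure unitary and occupations on `Orb Λ`
  refine ⟨fun P M => if (ofLex P).2 = (ofLex M).2 then U (ofLex M).2 (ofLex P).1 (ofLex M).1 else 0,
    fun M => ev (ofLex M).2 (ofLex M).1, ?_, ?_, fun M => hev0 _ _, fun M => hev1 _ _, ?_, ?_⟩
  · -- unitarity: the columns are orthonormal (spin by spin)
    rw [Matrix.mem_unitaryGroup_iff']
    ext M M'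
    rw [Matrix.mul_apply, sum_orb_eq_sum_sum, Matrix.one_apply]
    simp only [star_apply, ofLex_orb]
    have hcol := fun σ => sum_star_mul_of_mem_unitaryGroup (hUmem σ)
    by_cases hMM : (ofLex M).2 = (ofLex M').2
    · have e : ∀ x : Λ, (∑ ρ : Fin 2, star (if ρ = (ofLex M).2 then U (ofLex M).2 x (ofLex M).1 else 0) *
          (if ρ = (ofLex M').2 then U (ofLex M').2 x (ofLex M').1 else 0)) =
          star (U (ofLex M).2 x (ofLex M).1) * U (ofLex M).2 x (ofLex M').1 := by
        intro x
        rw [Finset.sum_eq_single (ofLex M).2]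
        · rw [if_pos rfl, ← hMM, if_pos rfl]
        · intro ρ _ hρ; rw [if_neg hρ, star_zero, zero_mul]
        · intro hh; exact absurd (Finset.mem_univ _) hh
      rw [Finset.sum_congr rfl fun x _ => e x, hcol]
      by_cases h' : M = M'
      · subst h'; simp
      · have : (ofLex M).1 ≠ (ofLex M').1 := by
          intro hc
          apply h'
          have : ofLex M = ofLex M' := Prod.ext hc hMM
          simpa using this
        rw [if_neg this, if_neg h']
    · have e : ∀ x : Λ, (∑ ρ : Fin 2, star (if ρ = (ofLex M).2 then U (ofLex M).2 x (ofLex M).1 else 0) *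
          (if ρ = (ofLex M').2 then U (ofLex M').2 x (ofLex M').1 else 0)) = 0 := by
        intro x
        refine Finset.sum_eq_zero fun ρ _ => ?_
        by_cases h1 : ρ = (ofLex M).2
        · rw [if_neg (show ¬(ρ = (ofLex M').2) from fun h2 => hMM (h1.symm.trans h2)), mul_zero]
        · rw [if_neg h1, star_zero, zero_mul]
      rw [Finset.sum_congr rfl fun x _ => e x, Finset.sum_const_zero]
      have : M ≠ M' := fun hc => hMM (by rw [hc])
      rw [if_neg this]
  · -- spin purity
    intro x m σ τ hστ
    simp only [ofLex_orb, if_neg hστ]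
  · -- `γ = Σ_M λ_M |w_M⟩⟨w_M|`
    ext P Q
    rw [occupationMatrix_apply, sum_orb_eq_sum_sum]
    simp only [ofLex_orb]
    -- write `P = (x, σ)`, `Q = (y, τ)`
    obtain ⟨x, σ⟩ := P
    obtain ⟨y, τ⟩ := Q
    change ∑ m : Λ, ∑ ρ : Fin 2, ((ev ρ m : ℝ) : ℂ) *
        ((if σ = ρ then U ρ x m else 0) * star (if τ = ρ then U ρ y m else 0)) = γ (orb x σ) (orb y τ)
    by_cases hστ : σ = τ
    · subst hστ
      rw [show γ (orb x σ) (orb y σ) = blk σ x y from rfl, ← hblkW σ, occupationMatrix_apply]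
      refine Finset.sum_congr rfl fun m _ => ?_
      rw [Finset.sum_eq_single σ]
      · rw [if_pos rfl, if_pos rfl]
      · intro ρ _ hρ; rw [if_neg (Ne.symm hρ), zero_mul, mul_zero]
      · intro hh; exact absurd (Finset.mem_univ _) hh
    · rw [hblock x y σ τ hστ]
      refine Finset.sum_eq_zero fun m _ => Finset.sum_eq_zero fun ρ _ => ?_
      by_cases h1 : σ = ρ
      · rw [if_neg (show ¬(τ = ρ) from fun h2 => hστ (h1.trans h2.symm)), star_zero, mul_zero, mul_zero]
      · rw [if_neg h1, zero_mul, mul_zero]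
  · -- block traces
    intro σ
    have e := (hpsd σ).1.trace_eq_sum_eigenvalues
    simp only [Matrix.trace, Matrix.diag_apply] at e
    rw [show (∑ x : Λ, γ (orb x σ) (orb x σ)) = ∑ x, blk σ x x from rfl, e]
    push_cast
    rfl

/-- **LIEB'S VARIATIONAL PRINCIPLE IN AN `S_z` SECTOR (unrestricted Hartree–Fock with fixed
`(N_α, N_β)`).** For a positive pair interaction and a SPIN-BLOCKED admissible one-matrix `γ`
(`γ_{xσ,yτ} = 0` for `σ ≠ τ`, `0 ≤ γ ≤ 1`) with block traces `Σ_x γ_{x↑,x↑} = a`,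
`Σ_x γ_{x↓,x↓} = b`, there is a spin-blocked Hermitian PROJECTION `P` with the same block traces and
`Re E(P, P∧P) ≤ Re E(γ, γ∧γ)`. This is BLS94 Theorem 2.12 / Bach's Theorem 3 one spin species at a
time: Bach's descent (III.8) is run among natural orbitals of equal spin only, which preserves
`(N_α, N_β)` (`exists_indicator_le_of_pairConcave_fibre`); the printed statements fix only
`N = N_α + N_β`. [cite: Bach2022LiebVariationalPrinciple, Thm 3] -/
theorem exists_isProj_spinBlocked_rdmEnergy_le (h : Λ → Λ → ℂ) {g : Λ → Λ → Λ → Λ → ℂ} (hnuc : ℂ)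
    (hV : (pairMatrix g).PosSemidef) {γ : Matrix (Orb Λ) (Orb Λ) ℂ} (hγ : γ.PosSemidef)
    (hγ1 : (1 - γ).PosSemidef)
    (hblock : ∀ (x y : Λ) (σ τ : Fin 2), σ ≠ τ → γ (orb x σ) (orb y τ) = 0) {a b : ℕ}
    (ha : ∑ x : Λ, γ (orb x 0) (orb x 0) = a) (hb : ∑ x : Λ, γ (orb x 1) (orb x 1) = b) :
    ∃ P : Matrix (Orb Λ) (Orb Λ) ℂ, P.IsHermitian ∧ P * P = P ∧
      (∀ (x y : Λ) (σ τ : Fin 2), σ ≠ τ → P (orb x σ) (orb y τ) = 0) ∧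
      ∑ x : Λ, P (orb x 0) (orb x 0) = a ∧ ∑ x : Λ, P (orb x 1) (orb x 1) = b ∧
      (rdmEnergy h g hnuc P (slaterTwoRDM P)).re ≤ (rdmEnergy h g hnuc γ (slaterTwoRDM γ)).re := by
  classical
  obtain ⟨W, l, hW, hWpure, h0, h1, hγW, hsums⟩ := exists_spinPure_occupationMatrix_eq hγ hγ1 hblock
  -- the spin colouring of the natural orbitals and its class sums
  set c : Orb Λ → Fin 2 := fun M => (ofLex M).2 with hc
  set N : Fin 2 → ℕ := ![a, b] with hN
  have hclass : ∀ σ (f : Orb Λ → ℝ), ∑ i ∈ univ.filter (fun i => c i = σ), f i = ∑ m : Λ, f (orb m σ) := by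
    intro σ f
    rw [Finset.sum_filter, sum_orb_eq_sum_sum]
    refine Finset.sum_congr rfl fun m _ => ?_
    simp only [hc, ofLex_orb, Finset.sum_ite_eq', Finset.mem_univ, if_true]
  have hNsum : ∀ σ, ∑ i ∈ univ.filter (fun i => c i = σ), l i = N σ := by
    refine Fin.forall_fin_two.mpr ⟨?_, ?_⟩
    · rw [hclass]
      have e := hsums 0
      rw [ha] at e
      simp only [hN, Matrix.cons_val_zero]
      exact_mod_cast e
    · rw [hclass]
      have e := hsums 1
      rw [hb] at e
      simp only [hN, Matrix.cons_val_one, Matrix.cons_val_zero]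
      exact_mod_cast e
  obtain ⟨S, hS, hle⟩ := exists_indicator_le_of_pairConcave_fibre c
    (fun l => (rdmEnergy h g hnuc (occupationMatrix W l) (slaterTwoRDM (occupationMatrix W l))).re)
    (fun l k j _ _ => re_rdmEnergy_occupationMatrix_pair hV h hnuc W l k j) h0 h1 N hNsum
  set P := occupationMatrix W (fun M => if M ∈ S then 1 else 0) with hP
  -- `P` is spin-blocked with block traces `(a, b)`
  have hPblock : ∀ (x y : Λ) (σ τ : Fin 2), σ ≠ τ → P (orb x σ) (orb y τ) = 0 := by
    intro x y σ τ hστ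
    rw [hP, occupationMatrix_indicator_apply]
    refine Finset.sum_eq_zero fun M _ => ?_
    obtain ⟨m, ρ⟩ := M
    change W (orb x σ) (orb m ρ) * star (W (orb y τ) (orb m ρ)) = 0
    by_cases h1 : σ = ρ
    · rw [hWpure y m τ ρ (fun h2 => hστ (h1.trans h2.symm)), star_zero, mul_zero]
    · rw [hWpure x m σ ρ h1, zero_mul]
  have hcolsq : ∀ (m : Λ) (ρ σ : Fin 2), ∑ x : Λ, W (orb x σ) (orb m ρ) * star (W (orb x σ) (orb m ρ)) =
      if ρ = σ then 1 else 0 := by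
    intro m ρ σ
    have hunit := sum_star_mul_of_mem_unitaryGroup hW (orb m ρ) (orb m ρ)
    rw [if_pos rfl, sum_orb_eq_sum_sum] at hunit
    by_cases hρσ : ρ = σ
    · subst hρσ
      rw [if_pos rfl, ← hunit]
      refine Finset.sum_congr rfl fun x _ => ?_
      rw [Finset.sum_eq_single ρ]
      · exact mul_comm _ _
      · intro τ _ hτ; rw [hWpure x m τ ρ hτ, mul_zero]
      · intro hh; exact absurd (Finset.mem_univ _) hh
    · rw [if_neg hρσ]
      exact Finset.sum_eq_zero fun x _ => by rw [hWpure x m σ ρ (Ne.symm hρσ), zero_mul]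
  have hPtrace : ∀ σ, ∑ x : Λ, P (orb x σ) (orb x σ) = N σ := by
    intro σ
    simp only [hP, occupationMatrix_indicator_apply]
    rw [Finset.sum_comm]
    have e : ∀ M ∈ S, ∑ x : Λ, W (orb x σ) M * star (W (orb x σ) M) = if c M = σ then 1 else 0 := by
      intro M _
      obtain ⟨m, ρ⟩ := M
      exact hcolsq m ρ σ
    rw [Finset.sum_congr rfl e, Finset.sum_boole, hS σ]
  refine ⟨P, occupationMatrix_isHermitian _ _, occupationMatrix_indicator_mul_self hW S, hPblock,
    ?_, ?_, ?_⟩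
  · have := hPtrace 0; simpa [hN] using this
  · have := hPtrace 1; simpa [hN] using this
  · rw [hγW] at hle; exact hle

/-- **`E₀(Ĥ; a, b) ≤ E₁(γ) + E₂(γ)` for every spin-blocked admissible `γ` with block traces
`(a, b)`** — the sector form of Lieb's bound used in quantum chemistry (UHF trial one-matrices with
definite `N_α = a`, `N_β = b`, not necessarily idempotent): for Hermitian integral data and a
positive pair interaction, the exact `S_z`-sector ground-state energy lies below `Re E(γ, γ∧γ)`
(the projection hypothesis of `sectorGroundEnergy_le_re_rdmEnergy_slaterTwoRDM` dropped). BLS94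
(2c.36) within the `(N_↑, N_↓) = (a, b)` sector. [cite: BachLiebSolovej1994, eq. (2c.36)] -/
theorem sectorGroundEnergy_le_re_rdmEnergy_of_le_one {h : Λ → Λ → ℂ} {g : Λ → Λ → Λ → Λ → ℂ}
    {hnuc : ℂ} (hH : (molecularHamiltonian h g hnuc).IsHermitian) (hV : (pairMatrix g).PosSemidef)
    {γ : Matrix (Orb Λ) (Orb Λ) ℂ} (hγ : γ.PosSemidef) (hγ1 : (1 - γ).PosSemidef)
    (hblock : ∀ (x y : Λ) (σ τ : Fin 2), σ ≠ τ → γ (orb x σ) (orb y τ) = 0) {a b : ℕ}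
    (ha : ∑ x : Λ, γ (orb x 0) (orb x 0) = a) (hb : ∑ x : Λ, γ (orb x 1) (orb x 1) = b) :
    sectorGroundEnergy (molecularHamiltonian h g hnuc) a b ≤
      (rdmEnergy h g hnuc γ (slaterTwoRDM γ)).re := by
  obtain ⟨P, hP, hPP, hPblock, hPa, hPb, hle⟩ :=
    exists_isProj_spinBlocked_rdmEnergy_le h hnuc hV hγ hγ1 hblock ha hb
  exact (sectorGroundEnergy_le_re_rdmEnergy_slaterTwoRDM hH hP hPP hPblock hPa hPb).trans hle

/-- **`E_PQG(a, b) ≤ E₁(γ) + E₂(γ)` for every spin-blocked admissible `γ` with block traces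
`(a, b)`**: the optimal value of the cell's sector `DQG` programme lies below Lieb's functional on the
spin-blocked admissible set (Nakata et al. (2008) §II.C chain composed with BLS94 (2c.36) in the
sector). [cite: BachLiebSolovej1994, eq. (2c.36)] -/
theorem pqgSectorEnergy_le_re_rdmEnergy_of_le_one (h : Λ → Λ → ℂ) {g : Λ → Λ → Λ → Λ → ℂ}
    (hnuc : ℂ) (hV : (pairMatrix g).PosSemidef) {γ : Matrix (Orb Λ) (Orb Λ) ℂ} (hγ : γ.PosSemidef)
    (hγ1 : (1 - γ).PosSemidef)
    (hblock : ∀ (x y : Λ) (σ τ : Fin 2), σ ≠ τ → γ (orb x σ) (orb y τ) = 0) {a b : ℕ}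
    (ha : ∑ x : Λ, γ (orb x 0) (orb x 0) = a) (hb : ∑ x : Λ, γ (orb x 1) (orb x 1) = b) :
    pqgSectorEnergy h g hnuc a b ≤ (rdmEnergy h g hnuc γ (slaterTwoRDM γ)).re := by
  obtain ⟨P, hP, hPP, hPblock, hPa, hPb, hle⟩ :=
    exists_isProj_spinBlocked_rdmEnergy_le h hnuc hV hγ hγ1 hblock ha hb
  exact (pqgSectorEnergy_le_re_rdmEnergy_slaterTwoRDM h g hnuc hP hPP hPblock hPa hPb).trans hle

end Sector

/-! ### Lieb's Theorem (i): an ensemble of determinants with one-matrix EXACTLY `γ` -/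

section Ensemble

variable {ι : Type*} [Fintype ι] [DecidableEq ι]

/-- **Randomised descent on the hypersimplex (Jensen form of Bach's algorithm).** For
`λ ∈ [0,1]^ι` with `Σ λ = N ∈ ℕ` there are convex weights `w_S ≥ 0` on the `N`-sets, `Σ_S w_S = 1`,
with MARGINALS `λ_a = Σ_{S ∋ a} w_S` — the decomposition of
`Literature.Analysis.Convex.exists_convexCombination_indicator` — which moreover satisfy
`Σ_S w_S F(1_S) ≤ F(λ)` for EVERY `F` that is a concave parabola along each direction `e_k − e_l`
(the hypothesis of `exists_indicator_le_of_pairConcave`). Proof: Bach's move (III.8) taken BOTH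
ways — to `λ + t₊(e_k − e_l)` with weight `t₋/(t₊ + t₋)` and to `λ − t₋(e_k − e_l)` with weight
`t₊/(t₊ + t₋)` — keeps the barycentre at `λ`, and a concave parabola lies above its chord; induction
on the number of fractional occupations. This finite convex combination of determinants of the
natural orbitals REPLACES Lieb's phase-averaged determinants `⟨ρ_N^θ⟩_θ` of the rotated orbitals
`F_k^θ = Σ_j e^{iθ_j} V^k_j f_j` (his Lemma); both yield a `ρ_N` with `ρ_N¹ = K`, `e(ρ_N) ≤ E(K)`.
[cite: Lieb1981VariationalPrinciple, Theorem (i) (proof)] -/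
theorem exists_convexCombination_indicator_pairConcave {l : ι → ℝ} (h0 : ∀ i, 0 ≤ l i)
    (h1 : ∀ i, l i ≤ 1) {N : ℕ} (hN : ∑ i, l i = N) :
    ∃ w : Finset ι → ℝ, (∀ S, 0 ≤ w S) ∧ (∀ S, w S ≠ 0 → S.card = N) ∧ ∑ S, w S = 1 ∧
      (∀ a, l a = ∑ S, w S * (if a ∈ S then 1 else 0)) ∧
      ∀ F : (ι → ℝ) → ℝ, (∀ (l : ι → ℝ) (k j : ι), k ≠ j → ∃ β ω : ℝ, 0 ≤ ω ∧
          ∀ t : ℝ, F (l + t • (Pi.single k 1 - Pi.single j 1)) = F l + β * t - ω * t ^ 2) →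
        ∑ S, w S * F (fun i => if i ∈ S then 1 else 0) ≤ F l := by
  suffices key : ∀ (m : ℕ) (l : ι → ℝ), (fracSet l).card = m → (∀ i, 0 ≤ l i) → (∀ i, l i ≤ 1) →
      ∑ i, l i = N → ∃ w : Finset ι → ℝ, (∀ S, 0 ≤ w S) ∧ (∀ S, w S ≠ 0 → S.card = N) ∧
        ∑ S, w S = 1 ∧ (∀ a, l a = ∑ S, w S * (if a ∈ S then 1 else 0)) ∧
        ∀ F : (ι → ℝ) → ℝ, (∀ (l : ι → ℝ) (k j : ι), k ≠ j → ∃ β ω : ℝ, 0 ≤ ω ∧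
            ∀ t : ℝ, F (l + t • (Pi.single k 1 - Pi.single j 1)) = F l + β * t - ω * t ^ 2) →
          ∑ S, w S * F (fun i => if i ∈ S then 1 else 0) ≤ F l from
    key _ l rfl h0 h1 hN
  intro m
  induction m using Nat.strong_induction_on with
  | _ m ih =>
    intro l hm h0 h1 hN
    by_cases he : fracSet l = ∅
    · -- a vertex of the hypersimplex: the point mass
      set S₀ : Finset ι := univ.filter fun i => l i = 1 with hS₀
      have hl : l = fun i => if i ∈ S₀ then (1 : ℝ) else 0 :=
        eq_indicator_of_fracSet_eq_empty h0 h1 he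
      have hcard : S₀.card = N := by
        have hs : ∑ i, l i = S₀.card := by
          conv_lhs => rw [hl]
          exact sum_indicator_eq_card _
        rw [hN] at hs
        exact_mod_cast hs.symm
      have hind : ∀ a, l a = if a ∈ S₀ then 1 else 0 := fun a => congrFun hl a
      refine ⟨fun S => if S = S₀ then 1 else 0, fun S => by positivity, fun S hS => ?_, ?_, ?_, ?_⟩
      · by_cases h : S = S₀
        · rw [h, hcard]
        · exact absurd (if_neg h) hS
      · rw [Finset.sum_ite_eq', if_pos (Finset.mem_univ _)]
      · intro a
        simp only [ite_mul, one_mul, zero_mul, Finset.sum_ite_eq', Finset.mem_univ, if_true]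
        exact hind a
      · intro F _
        simp only [ite_mul, one_mul, zero_mul, Finset.sum_ite_eq', Finset.mem_univ, if_true]
        exact (congrArg F hl.symm).le
    · -- two fractional coordinates `k ≠ j`: Bach's move along `e_k − e_j`, taken both ways
      obtain ⟨k, hk⟩ := Finset.nonempty_iff_ne_empty.mpr he
      obtain ⟨j, hj, hjk⟩ := exists_ne_mem_fracSet h0 h1 hN hk
      obtain ⟨htp, hp0, hp1, hpsum, hpcard⟩ := descentStep h0 h1 hjk.symm hk hj
      obtain ⟨htm, hm0, hm1, hmsum, hmcard⟩ := descentStep h0 h1 hjk hj hk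
      set tp : ℝ := min (1 - l k) (l j) with htp'
      set tm : ℝ := min (1 - l j) (l k) with htm'
      set lp : ι → ℝ := l + tp • (Pi.single k 1 - Pi.single j 1) with hlp
      set lm : ι → ℝ := l + tm • (Pi.single j 1 - Pi.single k 1) with hlm
      obtain ⟨wp, hwp0, hwpN, hwp1, hwpm, hwpF⟩ :=
        ih _ (hm ▸ hpcard) lp rfl hp0 hp1 (hpsum.trans hN)
      obtain ⟨wm, hwm0, hwmN, hwm1, hwmm, hwmF⟩ :=
        ih _ (hm ▸ hmcard) lm rfl hm0 hm1 (hmsum.trans hN)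
      -- the two end points coordinatewise, `d = e_k − e_j`
      set d : ι → ℝ := Pi.single k 1 - Pi.single j 1 with hd
      have hlpi : ∀ i, lp i = l i + tp * d i := fun i => by
        simp only [hlp, hd, Pi.add_apply, Pi.smul_apply, smul_eq_mul]
      have hlm' : lm = l + (-tm) • d := by
        rw [hlm, hd, neg_smul, smul_sub, smul_sub, neg_sub]
      have hlmi : ∀ i, lm i = l i - tm * d i := fun i => by
        simp only [hlm', Pi.add_apply, Pi.smul_apply, smul_eq_mul]
        ring
      -- weights `q` on the `+` end point and `1 − q` on the `−` end point, `q t₊ = (1 − q) t₋`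
      set q : ℝ := tm / (tp + tm) with hq
      have hsum_pos : 0 < tp + tm := by positivity
      have hq0 : 0 ≤ q := by positivity
      have h1q' : 1 - q = tp / (tp + tm) := by
        rw [hq, eq_div_iff hsum_pos.ne', sub_mul, div_mul_cancel₀ _ hsum_pos.ne']
        ring
      have h1q : 0 ≤ 1 - q := by rw [h1q']; positivity
      have hqt : q * tp = (1 - q) * tm := by
        rw [h1q', hq, div_mul_eq_mul_div, div_mul_eq_mul_div, mul_comm tm tp]
      have hmix : ∀ i, q * lp i + (1 - q) * lm i = l i := by
        intro i
        rw [hlpi, hlmi]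
        linear_combination (d i) * hqt
      refine ⟨fun S => q * wp S + (1 - q) * wm S, fun S => ?_, fun S hS => ?_, ?_, fun a => ?_,
        fun F hF => ?_⟩
      · have := hwp0 S; have := hwm0 S; positivity
      · by_contra hc
        have e1 : wp S = 0 := by by_contra h'; exact hc (hwpN S h')
        have e2 : wm S = 0 := by by_contra h'; exact hc (hwmN S h')
        exact hS (show q * wp S + (1 - q) * wm S = 0 by rw [e1, e2, mul_zero, mul_zero, add_zero])
      · simp only [Finset.sum_add_distrib, ← Finset.mul_sum, hwp1, hwm1]
        ring
      · simp only [add_mul, Finset.sum_add_distrib, mul_assoc, ← Finset.mul_sum, ← hwpm, ← hwmm]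
        exact (hmix a).symm
      · -- Jensen: `q F(λ₊) + (1 − q) F(λ₋) = F(λ) − ω (q t₊² + (1 − q) t₋²) ≤ F(λ)`
        obtain ⟨β, ω, hω, hline⟩ := hF l k j hjk.symm
        have eFp : F lp = F l + β * tp - ω * tp ^ 2 := hline tp
        have eFm : F lm = F l + β * (-tm) - ω * (-tm) ^ 2 := by rw [hlm', hd]; exact hline (-tm)
        simp only [add_mul, Finset.sum_add_distrib, mul_assoc, ← Finset.mul_sum]
        calc q * ∑ S, wp S * F (fun i => if i ∈ S then 1 else 0) +
              (1 - q) * ∑ S, wm S * F (fun i => if i ∈ S then 1 else 0)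
            ≤ q * F lp + (1 - q) * F lm :=
              add_le_add (mul_le_mul_of_nonneg_left (hwpF F hF) hq0)
                (mul_le_mul_of_nonneg_left (hwmF F hF) h1q)
          _ = F l + β * (q * tp - (1 - q) * tm) - ω * (q * tp ^ 2 + (1 - q) * tm ^ 2) := by
              rw [eFp, eFm]; ring
          _ ≤ F l := by
              rw [hqt, sub_self, mul_zero, add_zero]
              have : 0 ≤ ω * (q * tp ^ 2 + (1 - q) * tm ^ 2) := by positivity
              linarith

/-- **Negative pair dependence of the rounding** (the two properties of Lieb's weights that his
proof uses: marginals `c_a` and pair weights `c_a c_b − W_ab`, `W_ab = |Σ_i V^i_a V̄^i_b|² ≥ 0`):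
the convex weights may be chosen with `λ_a = Σ_{S ∋ a} w_S` and `Σ_{S ∋ a, b} w_S ≤ λ_a λ_b` for
`a ≠ b` (apply the Jensen form to the pair-concave `F(λ) = λ_a λ_b`).
[cite: Lieb1981VariationalPrinciple, Theorem (i) (proof)] -/
theorem exists_convexCombination_indicator_negDep {l : ι → ℝ} (h0 : ∀ i, 0 ≤ l i)
    (h1 : ∀ i, l i ≤ 1) {N : ℕ} (hN : ∑ i, l i = N) :
    ∃ w : Finset ι → ℝ, (∀ S, 0 ≤ w S) ∧ (∀ S, w S ≠ 0 → S.card = N) ∧ ∑ S, w S = 1 ∧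
      (∀ a, l a = ∑ S, w S * (if a ∈ S then 1 else 0)) ∧
      ∀ a b, a ≠ b →
        ∑ S, w S * ((if a ∈ S then 1 else 0) * (if b ∈ S then 1 else 0)) ≤ l a * l b := by
  obtain ⟨w, hw0, hwN, hw1, hwl, hwF⟩ := exists_convexCombination_indicator_pairConcave h0 h1 hN
  refine ⟨w, hw0, hwN, hw1, hwl, fun a b hab => hwF (fun l => l a * l b) fun l k j hkj => ?_⟩
  -- `(λ_a + t d_a)(λ_b + t d_b)` with `d = e_k − e_j`: `ω = −d_a d_b ≥ 0` since `a ≠ b`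
  set d : ι → ℝ := Pi.single k 1 - Pi.single j 1 with hd
  have hda : d a = (if a = k then 1 else 0) - (if a = j then 1 else 0) := by
    simp [hd, Pi.single_apply]
  have hdb : d b = (if b = k then 1 else 0) - (if b = j then 1 else 0) := by
    simp [hd, Pi.single_apply]
  have hdd : d a * d b ≤ 0 := by
    rw [hda, hdb]
    by_cases hak : a = k
    · subst hak
      rw [if_pos rfl, if_neg hkj, if_neg (Ne.symm hab)]
      split_ifs <;> norm_num
    · by_cases haj : a = j
      · subst haj
        rw [if_neg hak, if_pos rfl, if_neg (Ne.symm hab)]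
        split_ifs <;> norm_num
      · rw [if_neg hak, if_neg haj]
        norm_num
  refine ⟨d a * l b + d b * l a, -(d a * d b), by linarith, fun t => ?_⟩
  simp only [Pi.add_apply, Pi.smul_apply, smul_eq_mul]
  ring

/-- A convex (or any real-linear) combination of the one-matrices `γ(1_S)` is `γ` of the combined
occupation vector: `Σ_S w_S γ(1_S) = γ(Σ_S w_S 1_S)`. [cite: Bach2022LiebVariationalPrinciple, eq. (III.7)] -/
theorem sum_smul_occupationMatrix_indicator (W : Matrix ι ι ℂ) (w : Finset ι → ℝ) :
    ∑ S, (w S : ℂ) • occupationMatrix W (fun m => if m ∈ S then 1 else 0) =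
      occupationMatrix W (fun m => ∑ S, w S * (if m ∈ S then 1 else 0)) := by
  ext i k
  simp only [Matrix.sum_apply, Matrix.smul_apply, occupationMatrix_apply, smul_eq_mul,
    Complex.ofReal_sum, Complex.ofReal_mul, Finset.sum_mul, Finset.mul_sum]
  rw [Finset.sum_comm]
  exact Finset.sum_congr rfl fun m _ => Finset.sum_congr rfl fun S _ => by ring

/-- The occupation numbers of an admissible one-matrix lie in `[0, 1]` and sum to `N` (Lieb (1):
`0 ≤ K ≤ I`, `Tr K = N`). [cite: Lieb1981VariationalPrinciple, eq. (1)] -/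
private theorem eigenvalues_box {γ : Matrix ι ι ℂ} (hγ : γ.PosSemidef) (hγ1 : (1 - γ).PosSemidef)
    {N : ℕ} (htr : γ.trace = N) :
    (∀ m, 0 ≤ hγ.1.eigenvalues m) ∧ (∀ m, hγ.1.eigenvalues m ≤ 1) ∧
      ∑ m, hγ.1.eigenvalues m = N := by
  refine ⟨fun m => hγ.eigenvalues_nonneg m, fun m => ?_, ?_⟩
  · set v : ι → ℂ := ⇑(hγ.1.eigenvectorBasis m) with hv
    have hunit : star v ⬝ᵥ v = 1 := by
      rw [dotProduct_comm, hv]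
      simp only [← EuclideanSpace.inner_eq_star_dotProduct, inner_self_eq_norm_sq_to_K,
        hγ.1.eigenvectorBasis.orthonormal.1 m]
      simp
    have hev : γ *ᵥ v = ((hγ.1.eigenvalues m : ℝ) : ℂ) • v := by
      rw [hv, hγ.1.mulVec_eigenvectorBasis m, RCLike.real_smul_eq_coe_smul (K := ℂ)]
      rfl
    have hnn : (0 : ℂ) ≤ star v ⬝ᵥ ((1 - γ) *ᵥ v) := hγ1.dotProduct_mulVec_nonneg v
    rw [sub_mulVec, one_mulVec, dotProduct_sub, hev, dotProduct_smul, hunit, smul_eq_mul, mul_one,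
      ← Complex.ofReal_one, ← Complex.ofReal_sub, Complex.zero_le_real] at hnn
    linarith
  · have e := hγ.1.trace_eq_sum_eigenvalues
    rw [htr] at e
    apply RCLike.ofReal_injective (K := ℂ)
    push_cast
    exact e.symm

variable {Λ : Type*} [LinearOrder Λ] [Fintype Λ]

/-- **LIEB'S THEOREM (i): AN `N`-PARTICLE DENSITY MATRIX WITH ONE-MATRIX EXACTLY `K` AND
`e(ρ_N) ≤ E(K)`.** "Let `v` be positive semidefinite and let `K` be any admissible single-particle
operator. Then (i) there exists a density matrix `ρ_N` satisfying the Pauli principle such that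
`ρ_N¹ = K` and `e₀ ≤ e(ρ_N) ≤ E(K)`." Here, sharpening Coleman's decomposition
(`ColemanOneMatrixRepresentability.exists_slaterEnsemble_of_le_one`, same shape): there are a
unitary `U` (the entrywise conjugate of the natural-orbital unitary of `γ`) and convex weights `w_S`
on the `N`-sets with `γ = Σ_{|S|=N} w_S ¹D(Γ(U)|S⟩)` EXACTLY and mean energy
`Σ_S w_S Re⟨Γ(U)|S⟩| Ĥ |Γ(U)|S⟩⟩ ≤ Re E(γ, γ∧γ)`; the members `Γ(U)|S⟩` are unit `N`-particle
Slater determinants (`star_dotProduct_Gamma_single`, `isNParticle_Gamma_single_of_mem`). The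
ensemble is the randomised Bach descent (`exists_convexCombination_indicator_pairConcave`), not
Lieb's phase average. [cite: Lieb1981VariationalPrinciple, Theorem (i)] -/
theorem exists_slaterEnsemble_oneRDM_eq_expect_le (h : Λ → Λ → ℂ) {g : Λ → Λ → Λ → Λ → ℂ}
    (hnuc : ℂ) (hV : (pairMatrix g).PosSemidef) {γ : Matrix (Orb Λ) (Orb Λ) ℂ}
    (hγ : γ.PosSemidef) (hγ1 : (1 - γ).PosSemidef) {N : ℕ} (htr : γ.trace = N) :
    ∃ (U : Matrix (Orb Λ) (Orb Λ) ℂ) (w : Finset (Orb Λ) → ℝ),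
      U ∈ Matrix.unitaryGroup (Orb Λ) ℂ ∧ (∀ S, 0 ≤ w S) ∧
      ∑ S ∈ univ.powersetCard N, w S = 1 ∧
      γ = ∑ S ∈ univ.powersetCard N, (w S : ℂ) • oneRDM (Gamma U *ᵥ Pi.single S (1 : ℂ)) ∧
      ∑ S ∈ univ.powersetCard N, w S *
          (star (Gamma U *ᵥ Pi.single S (1 : ℂ)) ⬝ᵥ
            molecularHamiltonian h g hnuc *ᵥ (Gamma U *ᵥ Pi.single S (1 : ℂ))).re ≤
        (rdmEnergy h g hnuc γ (slaterTwoRDM γ)).re := by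
  classical
  set W : Matrix (Orb Λ) (Orb Λ) ℂ := (hγ.1.eigenvectorUnitary : Matrix (Orb Λ) (Orb Λ) ℂ) with hW
  have hWmem : W ∈ Matrix.unitaryGroup (Orb Λ) ℂ := hγ.1.eigenvectorUnitary.2
  obtain ⟨h0, h1, hsum⟩ := eigenvalues_box hγ hγ1 htr
  have hγW : occupationMatrix W hγ.1.eigenvalues = γ :=
    (eq_occupationMatrix_eigenvectorUnitary hγ.1).symm
  obtain ⟨w, hw0, hwN, hw1, hwl, hwF⟩ := exists_convexCombination_indicator_pairConcave h0 h1 hsum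
  have hU : W.map star ∈ Matrix.unitaryGroup (Orb Λ) ℂ :=
    Matrix.map_star_mem_unitaryGroup_iff.mpr hWmem
  -- `w` is supported on the `N`-sets: sums over `N`-sets are sums over all subsets
  have hzero : ∀ S, S ∉ univ.powersetCard N → w S = 0 := fun S hS => by
    by_contra h'
    exact hS (mem_powersetCard.mpr ⟨subset_univ S, hwN S h'⟩)
  have hsupp : ∀ f : Finset (Orb Λ) → ℝ,
      ∑ S ∈ univ.powersetCard N, w S * f S = ∑ S, w S * f S := fun f =>
    Finset.sum_subset (subset_univ _) fun S _ hS => by rw [hzero S hS, zero_mul]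
  have hsuppM : ∀ f : Finset (Orb Λ) → Matrix (Orb Λ) (Orb Λ) ℂ,
      ∑ S ∈ univ.powersetCard N, (w S : ℂ) • f S = ∑ S, (w S : ℂ) • f S := fun f =>
    Finset.sum_subset (subset_univ _) fun S _ hS => by rw [hzero S hS, Complex.ofReal_zero, zero_smul]
  -- the rotated determinants `Γ(U)|S⟩`: one-matrix `γ(1_S)`, energy `Re E(γ(1_S), γ(1_S)∧γ(1_S))`
  set F : (Orb Λ → ℝ) → ℝ := fun l =>
    (rdmEnergy h g hnuc (occupationMatrix W l) (slaterTwoRDM (occupationMatrix W l))).re with hFdef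
  have hdet : ∀ S : Finset (Orb Λ),
      oneRDM (Gamma (W.map star) *ᵥ Pi.single S (1 : ℂ)) =
          occupationMatrix W (fun m => if m ∈ S then 1 else 0) ∧
        (star (Gamma (W.map star) *ᵥ Pi.single S (1 : ℂ)) ⬝ᵥ
            molecularHamiltonian h g hnuc *ᵥ (Gamma (W.map star) *ᵥ Pi.single S (1 : ℂ))).re =
          F (fun m => if m ∈ S then 1 else 0) := by
    intro S
    set ψ := Gamma (W.map star) *ᵥ Pi.single S (1 : ℂ) with hψ
    have hn : star ψ ⬝ᵥ ψ = 1 := star_dotProduct_Gamma_single hU S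
    have hone : oneRDM ψ = occupationMatrix W (fun m => if m ∈ S then 1 else 0) := by
      ext i k
      rw [hψ, oneRDM_Gamma_single hU, occupationMatrix_indicator_apply]
      simp only [Matrix.map_apply, star_star]
    have htwo : twoRDM ψ = slaterTwoRDM (oneRDM ψ) := twoRDM_Gamma_single hU S
    refine ⟨hone, ?_⟩
    rw [← rdmEnergy_rdm h g hnuc hn, htwo, hone]
  refine ⟨W.map star, w, hU, hw0, ?_, ?_, ?_⟩
  · have e := hsupp fun _ => 1
    simp only [mul_one] at e
    rw [e, hw1]
  · rw [hsuppM, Finset.sum_congr rfl fun S _ => by rw [(hdet S).1],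
      sum_smul_occupationMatrix_indicator]
    have e : (fun m => ∑ S, w S * (if m ∈ S then (1 : ℝ) else 0)) = hγ.1.eigenvalues :=
      funext fun m => (hwl m).symm
    rw [e, hγW]
  · rw [hsupp, Finset.sum_congr rfl fun S _ => by rw [(hdet S).2]]
    have key := hwF F fun l k j _ => re_rdmEnergy_occupationMatrix_pair hV h hnuc W l k j
    have e : F hγ.1.eigenvalues = (rdmEnergy h g hnuc γ (slaterTwoRDM γ)).re := by
      simp only [hFdef, hγW]
    rwa [e] at key

/-- **Lieb's Theorem (i) in reduced-density-matrix language.** For a positive pair interaction and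
an admissible `γ` (`0 ≤ γ ≤ 1`, `tr γ = N`) there is a two-matrix `Γ` such that `(γ, Γ)` is
ENSEMBLE `N`-REPRESENTABLE (`NRepresentability.IsEnsembleNRepresentable`: the RDM pair of an
`N`-particle density matrix `ρ_N = Σ_j w_j |ψ_j⟩⟨ψ_j|`, here of Slater determinants) and
`Re E(γ, Γ) ≤ Re E(γ, γ∧γ)` — "`ρ_N¹ = K` and `e(ρ_N) ≤ E(K)`"; the lower bound `e₀ ≤ e(ρ_N)` of
(8) is `IsEnsembleNRepresentable.groundEnergy_le_re_rdmEnergy`. (Lieb: `ρ_N² = K₂ − L₂` with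
`L₂ ≥ 0`, `e(ρ_N) = E(K) − ½ Tr(L₂ v)`.) [cite: Lieb1981VariationalPrinciple, Theorem (i)] -/
theorem exists_isEnsembleNRepresentable_rdmEnergy_le (h : Λ → Λ → ℂ) {g : Λ → Λ → Λ → Λ → ℂ}
    (hnuc : ℂ) (hV : (pairMatrix g).PosSemidef) {γ : Matrix (Orb Λ) (Orb Λ) ℂ}
    (hγ : γ.PosSemidef) (hγ1 : (1 - γ).PosSemidef) {N : ℕ} (htr : γ.trace = N) :
    ∃ Γ : Matrix (Orb Λ × Orb Λ) (Orb Λ × Orb Λ) ℂ, IsEnsembleNRepresentable N γ Γ ∧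
      (rdmEnergy h g hnuc γ Γ).re ≤ (rdmEnergy h g hnuc γ (slaterTwoRDM γ)).re := by
  classical
  obtain ⟨U, w, hU, hw0, hw1, hγeq, hle⟩ :=
    exists_slaterEnsemble_oneRDM_eq_expect_le h hnuc hV hγ hγ1 htr
  refine ⟨∑ S ∈ univ.powersetCard N, (w S : ℂ) • twoRDM (Gamma U *ᵥ Pi.single S (1 : ℂ)), ?_, ?_⟩
  · rw [hγeq]
    exact isEnsembleNRepresentable_of_ensemble _ w _ (fun S _ => hw0 S) hw1
      fun S hS => ⟨isNParticle_Gamma_single_of_mem U hS, star_dotProduct_Gamma_single hU S⟩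
  · have hw1c : ∑ S ∈ univ.powersetCard N, (w S : ℂ) = 1 := by
      rw [← Complex.ofReal_sum, hw1, Complex.ofReal_one]
    refine le_of_eq_of_le ?_ hle
    conv_lhs => rw [hγeq]
    rw [rdmEnergy_sum_smul, hw1c, sub_self, zero_mul, add_zero, Complex.re_sum]
    refine Finset.sum_congr rfl fun S _ => ?_
    rw [Complex.re_ofReal_mul, rdmEnergy_rdm h g hnuc (star_dotProduct_Gamma_single hU S)]

end Ensemble

end Literature.MathematicalPhysics.QuantumChemistry

end
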